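import Mathlib.Analysis.SpecialFunctions.Pow.Continuity
import Literature.Barriers.CriticalPhenomena.WeaklySAWCouplingFlowProductRemainder
import HarnessLib

/-!
# BBS 2015, Lemma 8.3.3: the `ν₀`-derivative of the renormalisation-group flow — the induction
# with the remainders `Ř'_{j+1}, Ǩ'_{j+1}` and the `K`-coordinate, and `μ̌'_j = L^{2j}(ǧ_j/g₀)^γ(c + O(χ_jǧ_j))`

Companion ("proof architecture") file of `WeaklySAWFourDimLogCorrections.lean` (named fact
`CTWSAW.BBS2015_thm11` = Theorem 1.1 of Bauerschmidt–Brydges–Slade, CMP 337 (2015),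
arXiv:1403.7422, reduced in the tree to `CTWSAW.BBS2015_thm41` = Theorem 4.1), continuing
`WeaklySAWCouplingFlowRemainder.lean` / `WeaklySAWCouplingFlowProductRemainder.lean` (the flow
`ǧ_{j+1} = ǧ_j - β_jǧ_j² + r_j`, `CTWSAW.GchHyp`, and the product formula
`∏_{k<j}(1 - γβ_kǧ_k)⁻¹ = (g₀/ǧ_j)^γ P_j`, `P_j → c`) and `WeaklySAWFlowDerivative.lean` (the
perturbative skeleton `r = 0`, `K = 0` of the same lemma, by another hand). Theorem 4.1 is proved
in §8.4 from the identity `χ̂_N = m⁻² + m⁻⁴(-ν_N + |Λ|⁻¹D²W_N⁰ + |Λ|⁻¹D²K_N⁰)` by differentiating the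
flow in the initial condition `ν₀ = μ₀`: "the power `γ = ¼` for the logarithmic correction to the
susceptibility in `d = 4` arises in Lemma 8.3.3", which reads (held text, §8.3):

  **Lemma 8.3.3.** Let `d = 4`, `(m²,g₀) ∈ [0,δ) × (0,δ)`, `(z₀,μ₀) = (z₀ᶜ,μ₀ᶜ)`,
  `s_j = (m², g̃_j(m²,g₀))`. There exists a continuous function `c : [0,δ)² → ℝ`, which satisfies
  `c(m²,g₀) = 1 + O(g₀)`, such that for all `j ∈ ℕ₀`:
  `μ̌_j' = L^{2j}(ǧ_j/g₀)^γ(c(m²,g₀) + O(χ_jǧ_j))`, `ǧ_j' = O(μ̌_j'ǧ_j²)`, `ž_j' = O(χ_jμ̌_j'ǧ_j²)`.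
  Also … `‖K_j'‖_{𝒲_j(s_j,Λ_N)} = O(χ_jμ̌_j'ǧ_j²)`.

Its printed proof is an induction on `j` driven by the chain rule (display (8.40) by position,
"`F'(V̌_j,K_j) = D_V̌F(V̌_j,K_j)V̌_j' + D_KF(V̌_j,K_j)K_j'`" for `F = Ř_{j+1}, Ǩ_{j+1}`), the estimates of
Theorem 6.4.1 / Corollary 6.6.1 for `D_VŘ, D_KŘ, D_VǨ, D_KǨ`, the explicit quadratic flow `φ̄`
((6.x): `ḡ₊ = ḡ - βḡ²`, `z̄₊ = z̄ - θḡ²`, `μ̄₊ = L²μ̄(1 - γβḡ) + ηḡ - ξḡ² - πḡz̄`) with the bounds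
(A2) `θ_j, η_j, ξ_j, π_j = O(χ_j)`, the flow bounds `ž_j, μ̌_j = O(χ_jḡ_j)` (Proposition 8.1.1),
and `Π_j = L^{2j}∏_{l<j}(1 - γβ_lǧ_l)`:
  "We define `Σ_j` by `μ̌_j' = Π_j(1 + Σ_j)` … We make the inductive assumption that for `j < N`
  there exist `M₁ ≫ M₂ ≫ 1` such that `|Σ_j - Σ_{j-1}| ≤ O(M₁+M₂)χ_jḡ_j²`,
  `|ǧ_j'|, |ž_j'| ≤ M₁χ_jΠ_jḡ_j²`, `‖K_j'‖ ≤ M₂χ_jΠ_jḡ_j²`. Since `(ǧ₀',ž₀',μ̌₀',K₀') = (0,0,1,0)`,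
  the inductive assumption is true for `j = 0`. To advance the induction … if `L ≫ 1`, if
  `Ω ≤ L`, and if `g₀` is sufficiently small, then `|μ̌_j'| ≤ 2Π_j`,
  `χ_jΠ_jḡ_j² ≤ ½χ_{j+1}Π_{j+1}ḡ_{j+1}²`. … `‖D_VF(V̌_j,K_j)V̌_j'‖ ≤ O(χ_jḡ_j²)(M₁ḡ_j²+2)Π_j
  ≤ O(χ_jΠ_jḡ_j²)`, `‖D_KŘ_{j+1}K_j'‖ ≤ O(M₂)χ_jΠ_jḡ_j²`, `‖D_KǨ_{j+1}K_j'‖ ≤ M₂χ_jΠ_jḡ_j²` … This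
  implies, for `M₂ ≫ 1`, `‖Ř_{j+1}'‖ ≤ O(M₂)χ_jΠ_jḡ_j²`, `‖Ǩ_{j+1}'‖ ≤ 2M₂χ_jΠ_jḡ_j²`. For `μ̌`,
  the induction is advanced using the recursion with (mubar), … It follows that
  `μ̌_{j+1}' = L²μ̌_j'(1 - γβ_jǧ_j) + O((M₁+M₂)χ_jΠ_jḡ_j²) = Π_{j+1}(1+Σ_j) + O((M₁+M₂)χ_{j+1}Π_{j+1}ḡ_{j+1}²)`
  … `|ǧ_{j+1}'|, |ž_{j+1}'| ≤ (M₁(1+O(ḡ_j)) + O(M₂))χ_jΠ_jḡ_j² ≤ 2M₁χ_jΠ_jḡ_j² ≤ M₁χ_{j+1}Π_{j+1}ḡ_{j+1}²`.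
  … Since `Σ_{j≥1}χ_jḡ_j² = O(g₀)` … the limit `Σ_∞ = lim Σ_j = Σ_j(Σ_j - Σ_{j-1})` exists with
  `Σ_∞ = O(g₀)` … `Σ_∞ - Σ_j = O(Σ_{k>j}χ_kḡ_k²) = O(χ_jḡ_j)`. From (prodid)–(muPiSig) and (sumid), we
  obtain the equation for `μ̌_j'` with `c(m²,g₀) = (1 + Σ_∞)(1 + Γ_∞)` … With this, (induct1)
  implies the last two equations in (mugzprime) and (Kprime)."

## What this file does

It proves this induction and its consequences for ABSTRACT real sequences: the derivative
sequences `(ǧ'_j, ž'_j, μ̌'_j)` and the NORMS `k_j = ‖K'_j‖_{𝒲_j}` (the Banach spaces enter the printed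
argument only through these norms and the operator bounds), subject to exactly the printed inputs,
packaged in `CTWSAW.DerivFlow` (data) and `CTWSAW.DerivFlow.Hyp` (hypotheses): the differentiated
flow equations (the chain rule with `φ̄` of (6.x) and remainder contributions `ρ^g_j, ρ^z_j, ρ^μ_j`),
the step bounds `|ρ^u_j| ≤ Mχ_jǧ_j²‖V̌'_j‖ + M k_j`, `k_{j+1} ≤ Mχ_jǧ_j²‖V̌'_j‖ + κk_j` (Theorem 6.4.1 at
`(p,q) = (1,0), (0,1)`, with `‖V̌'‖ = max(|ǧ'|,|ž'|,|μ̌'|)`, the norm of `𝒱`), (A2), the flow bounds of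
Proposition 8.1.1, the weights `0 < χ_j ≤ 1`, `χ_j ≤ Ωχ_{j+1}` and `β_j ≤ Bχ_j` (the definition of the
`Ω`-scale `j_Ω` and of `χ_j = Ω^{-(j-j_Ω)₊}`), the tail bound `Σ_{l≥j}χ_lǧ_l² ≤ C_Σχ_jǧ_j`
((chigbd-bis), `n = 2`, "proved in [BBS-rg-flow]"), `L² ≥ 16Ω`, and the flow `ǧ` itself through the
tree's `CTWSAW.GchHyp` (`ǧ_{j+1} = ǧ_j - β_jǧ_j² + r_j`, with `|r_j| ≤ ρ_jǧ_j²`, `ρ_j ≤ Rχ_jǧ_j` for the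
product-formula part: "`r_j = O(χ_jǧ_j³)`"). Constants are explicit (`M₂ = 2M+1`, `M₄ = 2M + MM₂`,
`M₁ = 2M₄+1`, `M₃ = M₁(L²γBA + 4A + A²) + M₄`, `W = (32γB²/9 + 4R)C_Σ`) and "`g₀` sufficiently small"
is the explicit `DerivFlow.Small` (`4M₁g₀² ≤ 1`, `8Ag₀ ≤ 1`, `M₃C_Σg₀ ≤ 1`, `Wg₀ ≤ ¼`).

* `DerivFlow.prodPi` (`Π_j`), `prodPi_succ`, `prodPi_pos`; `DerivFlow.sig` (`Σ_j`), `DerivFlow.unit`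
  (`χ_jΠ_jǧ_j²`); **`Hyp.unit_succ_ge`** — "`χ_jΠ_jḡ_j² ≤ ½χ_{j+1}Π_{j+1}ḡ_{j+1}²`";
* `DerivFlow.IndAt` (the inductive assumption (induct1) at scale `j`), `Hyp.indAt_zero`,
  `Hyp.indAt_succ` (with the intermediate steps `abs_sig_le_half`, `dmu_mem` — "`|μ̌'_j| ≤ 2Π_j`" —,
  `nV_le`, `rem_le` — "`‖Ř'_{j+1}‖ ≤ O(M₂)χ_jΠ_jḡ_j²`" —, `dg_succ_le`, `dz_succ_le`, `k_succ_le'`,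
  `abs_err_le`, `abs_sig_succ_sub_le'`), and **`Hyp.inductive_bounds`** — (induct1) for all `j`:
  `|ǧ'_j|, |ž'_j| ≤ M₁χ_jΠ_jǧ_j²`, `k_j ≤ M₂χ_jΠ_jǧ_j²`, `|Σ_j| ≤ ½M₃Σ_{i≤j}χ_iǧ_i² ≤ ½`, with
  `Hyp.abs_sig_succ_sub_le` (`|Σ_{j+1} - Σ_j| ≤ ½M₃χ_{j+1}ǧ_{j+1}²`) and `Hyp.dmu_mem_all`
  (`½Π_j ≤ μ̌'_j ≤ (3/2)Π_j`);
* `DerivFlow.sigLim` (`Σ_∞`), **`Hyp.tendsto_sig`** (`Σ_j → Σ_∞`), `Hyp.abs_sigLim_le`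
  (`|Σ_∞| ≤ ½M₃C_Σg₀`, "`Σ_∞ = O(g₀)`"), `Hyp.abs_sigLim_sub_le`, `Hyp.abs_sigLim_sub_le'`
  (`|Σ_∞ - Σ_j| ≤ ½M₃C_Σχ_{j+1}ǧ_{j+1} ≤ M₃C_Σχ_jǧ_j`, "`Σ_∞ - Σ_j = O(χ_jḡ_j)`");
* `Hyp.prodPi_eq` (`Π_j = L^{2j}(ǧ_j/g₀)^γ/P_j`, the product formula), the tails of `log P`
  (`abs_log_stepFactorR_le'`, `summable_log_stepFactorR'` — also in the massless case —,
  `tsum_abs_log_tail_le`, `abs_tsum_log_sub_sum_le`, `abs_prodFactorRLim_div_sub_one_le`: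
  `|P_∞/P_n - 1| ≤ 2Wχ_nǧ_n`, `prodFactorRLim_bounds`: `|P_∞ - 1| ≤ 2Wg₀`, `prodFactorR_ge`);
* **`Hyp.dmu_eq`** — `μ̌'_j = L^{2j}(ǧ_j/g₀)^γ(1 + Σ_j)/P_j` EXACTLY, `Hyp.dmu_div_eq`, and
  **`Hyp.BBS2015_lem833`** — **the three displays (mugzprime) and (Kprime), PROVED** in the form:
  with `c = (1 + Σ_∞)/P_∞` (`DerivFlow.cConst`; `= (1+Σ_∞)(1+Γ_∞)` in the source's notation),
  `|c - 1| ≤ 2(M₃C_Σ + 4W)g₀` and, for all `j`,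
  `|μ̌'_j/(L^{2j}(ǧ_j/g₀)^γ) - c| ≤ (6W + 2M₃C_Σ)χ_jǧ_j`, `|ǧ'_j| ≤ 2M₁μ̌'_jǧ_j²`,
  `|ž'_j| ≤ 2M₁χ_jμ̌'_jǧ_j²`, `k_j ≤ 2M₂χ_jμ̌'_jǧ_j²` (`W = (32γB²/9 + 4R)C_Σ`, `DerivFlow.Wc`);
* `Hyp.tendsto_dmu_div` — `L^{-2j}μ̌'_j → c(ǧ_∞/g₀)^γ` if `ǧ_j → ǧ_∞` (the display
  "`lim_N ν_N' = c(m²,g₀)(ǧ_∞/g₀)^γ`" of §8.3, for `μ̌'` and `ν_N = L^{-2N}μ_N`).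

Everything is proved; no definition of a `Prop` without proof, no named fact. Not treated here:
the continuity of `c` in `(m², g₀)` (Proposition 8.2.2) and the existence of the flow and of its
derivative (Proposition 8.1.1, Theorem 6.4.1), which are the renormalisation-group input.

Locators: Lemma 8.3.3, Theorem 6.4.1, Proposition 8.1.1, Assumption (A2) by number/name (arXiv =
CMP numbering); displays by content (display numbers inside §6–§8 are not legible in the held text).
-/

noncomputable section

open Filter Topology Finset
open scoped BigOperators

namespace Literature.Barriers.CriticalPhenomena

namespace CTWSAW

/-! ### Elementary inequalities -/

/-- `|ab| ≤ A'B'` from `|a| ≤ A'`, `|b| ≤ B'`. [folklore] -/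
theorem abs_mul_le_mul {a b A' B' : ℝ} (ha : |a| ≤ A') (hb : |b| ≤ B') : |a * b| ≤ A' * B' := by
  rw [abs_mul]
  exact mul_le_mul ha hb (abs_nonneg _) ((abs_nonneg _).trans ha)

/-- `|abc| ≤ A'B'C'` from `|a| ≤ A'`, `|b| ≤ B'`, `|c| ≤ C'`. [folklore] -/
theorem abs_mul_mul_le {a b c A' B' C' : ℝ} (ha : |a| ≤ A') (hb : |b| ≤ B') (hc : |c| ≤ C') :
    |a * b * c| ≤ A' * B' * C' :=
  abs_mul_le_mul (abs_mul_le_mul ha hb) hc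

/-! ### The data of Lemma 8.3.3 -/

/-- The real sequences entering Lemma 8.3.3 and its proof: the weights `χ_j`, the coefficients
`β_j, θ_j, η_j, ξ_j, π_j` of the quadratic flow `φ̄`, the (transformed) flow `ǧ_j, ž_j, μ̌_j`, its
`ν₀ = μ₀`-derivative `ǧ'_j, ž'_j, μ̌'_j` (`dg, dz, dmu`), the norms `k_j = ‖K'_j‖_{𝒲_j}` of the
derivative of the `K`-coordinate, and the remainder contributions
`ρ^u_j = (D_VŘ^u_{j+1}V̌'_j + D_KŘ^u_{j+1}K'_j)` (`u = g, z, μ`) to the differentiated flow equation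
(the chain rule "`F'(V̌_j,K_j) = D_V̌F V̌'_j + D_KF K'_j`"). [cite: BauerschmidtBrydgesSlade2015LogCorr, Lemma 8.3.3 (proof: the sequences (V̌'_j, K'_j), Π_j, Σ_j)] -/
structure DerivFlow where
  /-- the weights `χ_j = Ω^{-(j-j_Ω)₊}` -/
  chi : ℕ → ℝ
  /-- `β_j` -/
  beta : ℕ → ℝ
  /-- `θ_j` -/
  theta : ℕ → ℝ
  /-- `η_j` -/
  eta : ℕ → ℝ
  /-- `ξ_j` -/
  xi : ℕ → ℝ
  /-- `π_j` -/
  pic : ℕ → ℝ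
  /-- `ǧ_j` -/
  g : ℕ → ℝ
  /-- `ž_j` -/
  z : ℕ → ℝ
  /-- `μ̌_j` -/
  mu : ℕ → ℝ
  /-- `ǧ'_j` -/
  dg : ℕ → ℝ
  /-- `ž'_j` -/
  dz : ℕ → ℝ
  /-- `μ̌'_j` -/
  dmu : ℕ → ℝ
  /-- `k_j = ‖K'_j‖_{𝒲_j}` -/
  k : ℕ → ℝ
  /-- `ρ^g_j`, the remainder contribution to `ǧ'_{j+1}` -/
  rg : ℕ → ℝ
  /-- `ρ^z_j` -/
  rz : ℕ → ℝ
  /-- `ρ^μ_j` -/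
  rmu : ℕ → ℝ

namespace DerivFlow

variable (D : DerivFlow)

/-- **`Π_j = L^{2j}∏_{l<j}(1 - γβ_lǧ_l)`**. [cite: BauerschmidtBrydgesSlade2015LogCorr, Lemma 8.3.3 (proof, definition of Π_j)] -/
def prodPi (L γ : ℝ) (j : ℕ) : ℝ :=
  L ^ (2 * j) * ∏ l ∈ range j, (1 - γ * (D.beta l * D.g l))

/-- **`Σ_j`**, defined by `μ̌'_j = Π_j(1 + Σ_j)`. [cite: BauerschmidtBrydgesSlade2015LogCorr, Lemma 8.3.3 (proof, definition of Σ_j)] -/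
def sig (L γ : ℝ) (j : ℕ) : ℝ :=
  D.dmu j / D.prodPi L γ j - 1

/-- The unit `χ_jΠ_jǧ_j²` of the inductive bounds. [cite: BauerschmidtBrydgesSlade2015LogCorr, Lemma 8.3.3 (proof, the inductive assumption)] -/
def unit (L γ : ℝ) (j : ℕ) : ℝ :=
  D.chi j * D.prodPi L γ j * D.g j ^ 2

/-- `‖V̌'_j‖_𝒱 = max(|ǧ'_j|, |ž'_j|, |μ̌'_j|)` (the maximum norm of `𝒱 = ℝ³` in the coordinates
`(g, z, μ)`). [cite: BauerschmidtBrydgesSlade2015LogCorr, §5.4 (the norm ‖V‖_𝒱 = max{|g|,|z|,|μ|})] -/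
def nV (j : ℕ) : ℝ :=
  max |D.dg j| (max |D.dz j| |D.dmu j|)

/-- `M₂ = 2M + 1`. [folklore] -/
def M2c (M : ℝ) : ℝ := 2 * M + 1

/-- `M₄ = 2M + MM₂` (the constant in `|ρ^u_j| ≤ M₄χ_jΠ_jǧ_j²`). [folklore] -/
def M4c (M : ℝ) : ℝ := 2 * M + M * M2c M

/-- `M₁ = 2M₄ + 1`. [folklore] -/
def M1c (M : ℝ) : ℝ := 2 * M4c M + 1

/-- `M₃ = M₁(L²γBA + 4A + A²) + M₄` (the constant in `μ̌'_{j+1} = Π_{j+1}(1+Σ_j) + O(χ_jΠ_jǧ_j²)`).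
[folklore] -/
def M3c (L γ A B M : ℝ) : ℝ := M1c M * (L ^ 2 * γ * B * A + 4 * A + A ^ 2) + M4c M

/-- `M₂ ≥ 1`, `M₂ ≥ 2M`. [folklore] -/
theorem M2c_ge {M : ℝ} (hM : 0 ≤ M) : 1 ≤ M2c M ∧ 2 * M ≤ M2c M := by
  unfold M2c; constructor <;> linarith

/-- `M₄ ≥ 0`. [folklore] -/
theorem M4c_nonneg {M : ℝ} (hM : 0 ≤ M) : 0 ≤ M4c M := by
  unfold M4c; nlinarith [(M2c_ge hM).1]

/-- `M₁ ≥ 1`, `M₁ ≥ 2M₄`. [folklore] -/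
theorem M1c_ge {M : ℝ} (hM : 0 ≤ M) : 1 ≤ M1c M ∧ 2 * M4c M ≤ M1c M := by
  unfold M1c; constructor <;> linarith [M4c_nonneg hM]

/-- `M₃ ≥ M₄ ≥ 0`. [folklore] -/
theorem M3c_ge {L γ A B M : ℝ} (hγ : 0 ≤ γ) (hA : 0 ≤ A) (hB : 0 ≤ B) (hM : 0 ≤ M) :
    M4c M ≤ M3c L γ A B M ∧ 0 ≤ M3c L γ A B M := by
  have h1 := (M1c_ge hM).1
  have h4 := M4c_nonneg hM
  have : 0 ≤ M1c M * (L ^ 2 * γ * B * A + 4 * A + A ^ 2) := by positivity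
  unfold M3c; constructor <;> linarith

/-- **The hypotheses of Lemma 8.3.3** on the data `D`, with constants `L` (scale ratio), `Ω`
(the decay rate of the weights), `γ` (`= ¼` in the source), `A` ((A2) and the flow bounds), `B`
(`β_j ≤ Bχ_j`), `M, κ` (Theorem 6.4.1) and `C_Σ` (the tail bound (chigbd-bis), `n = 2`):
* `L > 0`, `16Ω ≤ L²`, `1 ≤ Ω` ("if `L ≫ 1`, if `Ω ≤ L`"); `0 ≤ γ ≤ 1`;
* weights: `0 < χ_j ≤ 1`, `χ_{j+1} ≤ χ_j ≤ Ωχ_{j+1}` (true for `χ_j = Ω^{-(j-j_Ω)₊}`), and `β_j ≤ Bχ_j` (the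
  definition of `j_Ω`: "`|β_j| ≤ Ω^{-(j-k)}‖β‖_∞` for all `j`");
* the tail bound `Σ_{l≥j}χ_lǧ_l² ≤ C_Σχ_jǧ_j` for all `j` ((chigbd-bis) with `n = 2`, [BBS-rg-flow]);
* (A2): `|θ_j|, |η_j|, |ξ_j|, |π_j| ≤ Aχ_j`; Proposition 8.1.1: `|ž_j|, |μ̌_j| ≤ Aχ_jǧ_j`;
* the initial condition `(ǧ₀', ž₀', μ̌₀', K₀') = (0,0,1,0)`, `k_j ≥ 0`;
* the differentiated flow equations — the `V̌`-rows of the chain rule applied to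
  `V̌_{j+1} = φ̄_j(V̌_j) + Ř_{j+1}(V̌_j,K_j)` with `φ̄` the quadratic flow
  (`ḡ₊ = ḡ - βḡ²`, `z̄₊ = z̄ - θḡ²`, `μ̄₊ = L²μ̄(1-γβḡ) + ηḡ - ξḡ² - πḡz̄`):
  `ǧ'_{j+1} = (1 - 2β_jǧ_j)ǧ'_j + ρ^g_j`, `ž'_{j+1} = ž'_j - 2θ_jǧ_jǧ'_j + ρ^z_j`,
  `μ̌'_{j+1} = L²(1-γβ_jǧ_j)μ̌'_j - L²γβ_jμ̌_jǧ'_j + η_jǧ'_j - 2ξ_jǧ_jǧ'_j - π_j(ǧ'_jž_j + ǧ_jž'_j) + ρ^μ_j`;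
* the step bounds of Theorem 6.4.1 / Corollary 6.6.1 at `(p,q) = (1,0)` and `(0,1)`
  (`‖D_VŘ‖ ≤ Mχǧ²`, `‖D_KŘ‖ ≤ M`, `‖D_VǨ‖ ≤ Mχǧ²`, `‖D_KǨ‖ ≤ κ ≤ 1`) applied to `(V̌'_j, K'_j)`:
  `|ρ^u_j| ≤ Mχ_jǧ_j²‖V̌'_j‖ + Mk_j` and `k_{j+1} ≤ Mχ_jǧ_j²‖V̌'_j‖ + κk_j`.
The flow `ǧ` itself (`ǧ_{j+1} = ǧ_j - β_jǧ_j² + r_j`, `0 ≤ β_j ≤ B`, smallness) is supplied separately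
as `CTWSAW.GchHyp D.beta ρ D.g B g₀`. [cite: BauerschmidtBrydgesSlade2015LogCorr, Lemma 8.3.3 (proof: the inputs (fvflow), Theorem 6.4.1, (A2), Proposition 8.1.1, (chigbd-bis))] -/
structure Hyp (L Ω γ A B M κ CS : ℝ) : Prop where
  /-- `L > 0`. -/
  L_pos : 0 < L
  /-- `Ω ≥ 1`. -/
  one_le_Ω : 1 ≤ Ω
  /-- `L² ≥ 16Ω` ("`L ≫ 1`, `Ω ≤ L`"). -/
  L_sq : 16 * Ω ≤ L ^ 2
  /-- `γ ≥ 0`. -/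
  γ_nonneg : 0 ≤ γ
  /-- `γ ≤ 1`. -/
  γ_le_one : γ ≤ 1
  /-- `A ≥ 0`. -/
  A_nonneg : 0 ≤ A
  /-- `M ≥ 0`. -/
  M_nonneg : 0 ≤ M
  /-- `κ ≥ 0`. -/
  κ_nonneg : 0 ≤ κ
  /-- `κ ≤ 1`. -/
  κ_le_one : κ ≤ 1
  /-- `C_Σ ≥ 0`. -/
  CS_nonneg : 0 ≤ CS
  /-- `χ_j > 0`. -/
  chi_pos : ∀ j, 0 < D.chi j
  /-- `χ_j ≤ 1`. -/
  chi_le_one : ∀ j, D.chi j ≤ 1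
  /-- `χ_j ≤ Ωχ_{j+1}`. -/
  chi_le : ∀ j, D.chi j ≤ Ω * D.chi (j + 1)
  /-- `χ_{j+1} ≤ χ_j`. -/
  chi_succ_le : ∀ j, D.chi (j + 1) ≤ D.chi j
  /-- `β_j ≤ Bχ_j`. -/
  beta_le_chi : ∀ j, D.beta j ≤ B * D.chi j
  /-- `Σ_lχ_lǧ_l² < ∞`. -/
  summable : Summable fun l => D.chi l * D.g l ^ 2
  /-- `Σ_{l≥j}χ_lǧ_l² ≤ C_Σχ_jǧ_j`. -/
  tail_le : ∀ j, ∑' l, D.chi (l + j) * D.g (l + j) ^ 2 ≤ CS * D.chi j * D.g j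
  /-- `|θ_j| ≤ Aχ_j`. -/
  theta_le : ∀ j, |D.theta j| ≤ A * D.chi j
  /-- `|η_j| ≤ Aχ_j`. -/
  eta_le : ∀ j, |D.eta j| ≤ A * D.chi j
  /-- `|ξ_j| ≤ Aχ_j`. -/
  xi_le : ∀ j, |D.xi j| ≤ A * D.chi j
  /-- `|π_j| ≤ Aχ_j`. -/
  pic_le : ∀ j, |D.pic j| ≤ A * D.chi j
  /-- `|ž_j| ≤ Aχ_jǧ_j`. -/
  z_le : ∀ j, |D.z j| ≤ A * D.chi j * D.g j
  /-- `|μ̌_j| ≤ Aχ_jǧ_j`. -/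
  mu_le : ∀ j, |D.mu j| ≤ A * D.chi j * D.g j
  /-- `ǧ₀' = 0`. -/
  dg_zero : D.dg 0 = 0
  /-- `ž₀' = 0`. -/
  dz_zero : D.dz 0 = 0
  /-- `μ̌₀' = 1`. -/
  dmu_zero : D.dmu 0 = 1
  /-- `K₀' = 0`. -/
  k_zero : D.k 0 = 0
  /-- `k_j ≥ 0` (a norm). -/
  k_nonneg : ∀ j, 0 ≤ D.k j
  /-- the `ǧ`-row of the differentiated flow equation. -/
  rec_g : ∀ j, D.dg (j + 1) = (1 - 2 * D.beta j * D.g j) * D.dg j + D.rg j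
  /-- the `ž`-row. -/
  rec_z : ∀ j, D.dz (j + 1) = D.dz j - 2 * D.theta j * D.g j * D.dg j + D.rz j
  /-- the `μ̌`-row. -/
  rec_mu : ∀ j, D.dmu (j + 1) =
    L ^ 2 * (1 - γ * (D.beta j * D.g j)) * D.dmu j - L ^ 2 * γ * D.beta j * D.mu j * D.dg j
      + D.eta j * D.dg j - 2 * D.xi j * D.g j * D.dg j
      - D.pic j * (D.dg j * D.z j + D.g j * D.dz j) + D.rmu j
  /-- `|ρ^g_j| ≤ Mχ_jǧ_j²‖V̌'_j‖ + Mk_j`. -/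
  rg_le : ∀ j, |D.rg j| ≤ M * D.chi j * D.g j ^ 2 * D.nV j + M * D.k j
  /-- `|ρ^z_j| ≤ Mχ_jǧ_j²‖V̌'_j‖ + Mk_j`. -/
  rz_le : ∀ j, |D.rz j| ≤ M * D.chi j * D.g j ^ 2 * D.nV j + M * D.k j
  /-- `|ρ^μ_j| ≤ Mχ_jǧ_j²‖V̌'_j‖ + Mk_j`. -/
  rmu_le : ∀ j, |D.rmu j| ≤ M * D.chi j * D.g j ^ 2 * D.nV j + M * D.k j
  /-- `k_{j+1} ≤ Mχ_jǧ_j²‖V̌'_j‖ + κk_j`. -/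
  k_succ_le : ∀ j, D.k (j + 1) ≤ M * D.chi j * D.g j ^ 2 * D.nV j + κ * D.k j

/-- `W = (32γB²/9 + 4R)C_Σ`, the constant of the tail `Σ_{k≥n}|log F_k| ≤ Wχ_nǧ_n` of the product
formula (`F_k` the factors of `P_n`, `|log F_k| ≤ (32/9)γt_k² + 4|s_k|`, `t_k = β_kǧ_k ≤ Bχ_kǧ_k`,
`|s_k| ≤ ρ_kǧ_k ≤ Rχ_kǧ_k²`). [folklore] -/
def Wc (γ B R CS : ℝ) : ℝ := (32 / 9 * γ * B ^ 2 + 4 * R) * CS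

/-- `W ≥ 0`. [folklore] -/
theorem Wc_nonneg {γ B R CS : ℝ} (hγ : 0 ≤ γ) (hR : 0 ≤ R) (hCS : 0 ≤ CS) : 0 ≤ Wc γ B R CS := by
  unfold Wc; positivity

/-- **"`g₀` sufficiently small"** (depending on `L, γ, A, B, M, C_Σ, R`): `4M₁g₀² ≤ 1`, `8Ag₀ ≤ 1`,
`M₃C_Σg₀ ≤ 1`, `Wg₀ ≤ ¼`. [cite: BauerschmidtBrydgesSlade2015LogCorr, Lemma 8.3.3 (proof, "if g₀ is sufficiently small")] -/
structure Small (L γ A B M CS R g₀ : ℝ) : Prop where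
  /-- `4M₁g₀² ≤ 1` (so that `M₁χ_jΠ_jǧ_j² ≤ Π_j`). -/
  sq_le : 4 * M1c M * g₀ ^ 2 ≤ 1
  /-- `8Ag₀ ≤ 1`. -/
  A_le : 8 * A * g₀ ≤ 1
  /-- `M₃C_Σg₀ ≤ 1` (so that `|Σ_j| ≤ ½`). -/
  sig_le : M3c L γ A B M * CS * g₀ ≤ 1
  /-- `Wg₀ ≤ ¼` (so that `Wχ_nǧ_n ≤ 2Wg₀ ≤ ½` and `P_n, P_∞ ≥ ½`). -/
  W_le : Wc γ B R CS * g₀ ≤ 1 / 4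

/-! ### `Π_j`: recursion, positivity, and "`χ_jΠ_jǧ_j² ≤ ½χ_{j+1}Π_{j+1}ǧ_{j+1}²`" -/

/-- `Π₀ = 1`. [cite: BauerschmidtBrydgesSlade2015LogCorr, Lemma 8.3.3 (proof, definition of Π_j)] -/
@[simp] theorem prodPi_zero (L γ : ℝ) : D.prodPi L γ 0 = 1 := by
  simp [prodPi]

/-- `Π_{j+1} = L²(1 - γβ_jǧ_j)Π_j`. [cite: BauerschmidtBrydgesSlade2015LogCorr, Lemma 8.3.3 (proof, definition of Π_j)] -/
theorem prodPi_succ (L γ : ℝ) (j : ℕ) :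
    D.prodPi L γ (j + 1) = L ^ 2 * (1 - γ * (D.beta j * D.g j)) * D.prodPi L γ j := by
  unfold prodPi
  rw [prod_range_succ, show 2 * (j + 1) = 2 * j + 2 by ring, pow_add]
  ring

section GchOnly

variable {ρ : ℕ → ℝ} {B g₀ γ : ℝ} (hG : GchHyp D.beta ρ D.g B g₀)
include hG

/-- `¾ ≤ 1 - γβ_jǧ_j ≤ 1` for `γ ∈ [0,1]` (`β_jǧ_j ∈ [0,¼]`). [cite: BauerschmidtBrydgesSlade2015Flow, Lemma 2.1 (proof of (i): β_jḡ_j small)] -/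
theorem one_sub_mem (hγ0 : 0 ≤ γ) (hγ1 : γ ≤ 1) (j : ℕ) :
    3 / 4 ≤ 1 - γ * (D.beta j * D.g j) ∧ 1 - γ * (D.beta j * D.g j) ≤ 1 := by
  obtain ⟨h0, h1⟩ := hG.beta_mul_mem j
  constructor <;> nlinarith

/-- **`Π_j > 0`** (`L > 0`, `γ ∈ [0,1]`). [cite: BauerschmidtBrydgesSlade2015LogCorr, Lemma 8.3.3 (proof, Π_j)] -/
theorem prodPi_pos {L : ℝ} (hL : 0 < L) (hγ0 : 0 ≤ γ) (hγ1 : γ ≤ 1) (j : ℕ) :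
    0 < D.prodPi L γ j := by
  unfold prodPi
  refine mul_pos (pow_pos hL _) (prod_pos fun l _ => ?_)
  linarith [(D.one_sub_mem hG hγ0 hγ1 l).1]

/-- `Π_{j+1} ≥ ¾L²Π_j`. [cite: BauerschmidtBrydgesSlade2015LogCorr, Lemma 8.3.3 (proof, the display |μ̌'_j| ≤ 2Π_j, χ_jΠ_jḡ_j² ≤ ½χ_{j+1}Π_{j+1}ḡ_{j+1}²)] -/
theorem prodPi_succ_ge {L : ℝ} (hL : 0 < L) (hγ0 : 0 ≤ γ) (hγ1 : γ ≤ 1) (j : ℕ) :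
    3 / 4 * L ^ 2 * D.prodPi L γ j ≤ D.prodPi L γ (j + 1) := by
  rw [D.prodPi_succ]
  have hP := (D.prodPi_pos hG hL hγ0 hγ1 j).le
  have h34 := (D.one_sub_mem hG hγ0 hγ1 j).1
  have hL2 : 0 ≤ L ^ 2 := sq_nonneg L
  nlinarith [mul_nonneg hL2 hP]

end GchOnly

/-- **The inductive bounds (induct1) at scale `j`**: `|ǧ'_j|, |ž'_j| ≤ M₁χ_jΠ_jǧ_j²`,
`k_j ≤ M₂χ_jΠ_jǧ_j²`, and `|Σ_j| ≤ ½M₃Σ_{i=1}^{j}χ_iǧ_i²` (the telescoped form of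
`|Σ_i - Σ_{i-1}| ≤ ½M₃χ_iǧ_i²`, `i ≤ j`, `Σ₀ = 0`). [cite: BauerschmidtBrydgesSlade2015LogCorr, Lemma 8.3.3 (proof, the inductive assumption (induct1))] -/
structure IndAt (L γ M₁ M₂ M₃ : ℝ) (j : ℕ) : Prop where
  /-- `|ǧ'_j| ≤ M₁χ_jΠ_jǧ_j²`. -/
  dg_le : |D.dg j| ≤ M₁ * D.unit L γ j
  /-- `|ž'_j| ≤ M₁χ_jΠ_jǧ_j²`. -/
  dz_le : |D.dz j| ≤ M₁ * D.unit L γ j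
  /-- `k_j ≤ M₂χ_jΠ_jǧ_j²`. -/
  k_le : D.k j ≤ M₂ * D.unit L γ j
  /-- `|Σ_j| ≤ ½M₃Σ_{i=1}^{j}χ_iǧ_i²`. -/
  sig_le : |D.sig L γ j| ≤ M₃ / 2 * ∑ i ∈ range j, D.chi (i + 1) * D.g (i + 1) ^ 2

/-- **`Σ_∞ = Σ_{j≥0}(Σ_{j+1} - Σ_j)`** (`= lim_j Σ_j`, `Σ₀ = 0`; `Hyp.tendsto_sig`).
[cite: BauerschmidtBrydgesSlade2015LogCorr, Lemma 8.3.3 (proof, "the limit Σ_∞ = lim Σ_j = Σ_j(Σ_j - Σ_{j-1}) exists")] -/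
def sigLim (L γ : ℝ) : ℝ :=
  ∑' j, (D.sig L γ (j + 1) - D.sig L γ j)

/-- **`c = (1 + Σ_∞)/P_∞`** — the source's `c(m²,g₀) = (1 + Σ_∞)(1 + Γ_∞)`, `1 + Γ_∞ = 1/P_∞` being the
limit of the product formula `∏_{l<j}(1 - γβ_lǧ_l) = (ǧ_j/g₀)^γ/P_j` (`P_∞ = prodFactorRLim`).
[cite: BauerschmidtBrydgesSlade2015LogCorr, Lemma 8.3.3 (proof, "c(m²,g₀) = (1 + Σ_∞(m²,g₀))(1 + Γ_∞(m²,g₀))")] -/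
def cConst (L γ : ℝ) : ℝ :=
  (1 + D.sigLim L γ) / prodFactorRLim D.beta D.g γ

namespace Hyp

variable {D}
variable {L Ω γ A B M κ CS R : ℝ} {ρ : ℕ → ℝ} {g₀ : ℝ}
variable (h : D.Hyp L Ω γ A B M κ CS) (hG : GchHyp D.beta ρ D.g B g₀)
include h hG

/-! ### Derived elementary bounds -/

/-- `χ_jΠ_jǧ_j² ≥ 0`. [folklore] -/
theorem unit_nonneg (j : ℕ) : 0 ≤ D.unit L γ j := by
  unfold unit
  exact mul_nonneg (mul_nonneg (h.chi_pos j).le (D.prodPi_pos hG h.L_pos h.γ_nonneg h.γ_le_one j).le)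
    (sq_nonneg _)

/-- **"`χ_jΠ_jḡ_j² ≤ ½χ_{j+1}Π_{j+1}ḡ_{j+1}²`"** (here with `ǧ`; from `χ_j ≤ Ωχ_{j+1}`,
`Π_{j+1} ≥ ¾L²Π_j`, `ǧ_{j+1} ≥ ½ǧ_j` and `L² ≥ 16Ω`). [cite: BauerschmidtBrydgesSlade2015LogCorr, Lemma 8.3.3 (proof, the display |μ̌'_j| ≤ 2Π_j, χ_jΠ_jḡ_j² ≤ ½χ_{j+1}Π_{j+1}ḡ_{j+1}²)] -/
theorem unit_succ_ge (j : ℕ) : 2 * D.unit L γ j ≤ D.unit L γ (j + 1) := by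
  have hΩ : 0 < Ω := lt_of_lt_of_le zero_lt_one h.one_le_Ω
  have hχ : D.chi j ≤ Ω * D.chi (j + 1) := h.chi_le j
  have hχ0 : 0 ≤ D.chi j := (h.chi_pos j).le
  have hP : 3 / 4 * L ^ 2 * D.prodPi L γ j ≤ D.prodPi L γ (j + 1) :=
    D.prodPi_succ_ge hG h.L_pos h.γ_nonneg h.γ_le_one j
  have hP0 : 0 ≤ D.prodPi L γ j := (D.prodPi_pos hG h.L_pos h.γ_nonneg h.γ_le_one j).le
  have hP0' : 0 ≤ 3 / 4 * L ^ 2 * D.prodPi L γ j := by positivity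
  have hg : D.g j / 2 ≤ D.g (j + 1) := hG.g_succ_ge j
  have hg0 : 0 ≤ D.g j / 2 := by linarith [(hG.g_pos j).le]
  have hgsq : (D.g j / 2) ^ 2 ≤ D.g (j + 1) ^ 2 := pow_le_pow_left₀ hg0 hg 2
  -- `Ω u_{j+1} ≥ χ_j · (¾L²Π_j) · (ǧ_j/2)²`
  have h1 : D.chi j * (3 / 4 * L ^ 2 * D.prodPi L γ j) * (D.g j / 2) ^ 2 ≤
      Ω * D.chi (j + 1) * D.prodPi L γ (j + 1) * D.g (j + 1) ^ 2 := by
    have := mul_le_mul (mul_le_mul hχ hP hP0' (mul_nonneg hΩ.le (h.chi_pos (j + 1)).le)) hgsq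
      (sq_nonneg _) (mul_nonneg (mul_nonneg hΩ.le (h.chi_pos (j + 1)).le)
        (D.prodPi_pos hG h.L_pos h.γ_nonneg h.γ_le_one (j + 1)).le)
    linarith [this]
  have hu : 0 ≤ D.unit L γ j := h.unit_nonneg hG j
  unfold unit at hu ⊢
  have hL : 16 * Ω ≤ L ^ 2 := h.L_sq
  -- `χ_j(¾L²Π_j)(ǧ_j/2)² = (3/16)L²u_j ≥ 3Ωu_j`
  have h2 : 3 * Ω * (D.chi j * D.prodPi L γ j * D.g j ^ 2) ≤
      D.chi j * (3 / 4 * L ^ 2 * D.prodPi L γ j) * (D.g j / 2) ^ 2 := by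
    have : D.chi j * (3 / 4 * L ^ 2 * D.prodPi L γ j) * (D.g j / 2) ^ 2 =
        3 / 16 * L ^ 2 * (D.chi j * D.prodPi L γ j * D.g j ^ 2) := by ring
    rw [this]
    nlinarith
  have h3 : 3 * Ω * (D.chi j * D.prodPi L γ j * D.g j ^ 2) ≤
      Ω * (D.chi (j + 1) * D.prodPi L γ (j + 1) * D.g (j + 1) ^ 2) := by
    linarith [h1, h2]
  have h4 := le_of_mul_le_mul_left (by linarith [h3] :
      Ω * (3 * (D.chi j * D.prodPi L γ j * D.g j ^ 2)) ≤
        Ω * (D.chi (j + 1) * D.prodPi L γ (j + 1) * D.g (j + 1) ^ 2)) hΩ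
  linarith

/-- `Σ_{i=1}^{j}χ_iǧ_i² ≤ Σ_{l≥0}χ_lǧ_l² ≤ C_Σg₀` (the tail bound at `j = 0`, `χ₀ ≤ 1`, `ǧ₀ = g₀`).
[cite: BauerschmidtBrydgesSlade2015LogCorr, Lemma 8.3.3 (proof, "Since Σ_{j≥1}χ_jḡ_j² = O(g₀)")] -/
theorem sum_chi_mul_sq_le (j : ℕ) :
    ∑ i ∈ range j, D.chi (i + 1) * D.g (i + 1) ^ 2 ≤ CS * g₀ := by
  have hnn : ∀ l, 0 ≤ D.chi l * D.g l ^ 2 := fun l => mul_nonneg (h.chi_pos l).le (sq_nonneg _)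
  have h1 : ∑ i ∈ range j, D.chi (i + 1) * D.g (i + 1) ^ 2 ≤
      ∑ i ∈ range (j + 1), D.chi i * D.g i ^ 2 := by
    rw [sum_range_succ']
    linarith [hnn 0]
  have h2 : ∑ i ∈ range (j + 1), D.chi i * D.g i ^ 2 ≤ ∑' l, D.chi l * D.g l ^ 2 :=
    h.summable.sum_le_tsum (range (j + 1)) fun l _ => hnn l
  have h3 : ∑' l, D.chi l * D.g l ^ 2 ≤ CS * D.chi 0 * D.g 0 := by simpa using h.tail_le 0
  have h4 : CS * D.chi 0 * D.g 0 ≤ CS * g₀ := by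
    rw [hG.init]
    have h5 : 0 ≤ CS * g₀ * (1 - D.chi 0) :=
      mul_nonneg (mul_nonneg h.CS_nonneg hG.pos₀.le) (sub_nonneg.2 (h.chi_le_one 0))
    nlinarith [h5]
  linarith

omit h in
/-- `0 ≤ β_j ≤ B` and `B ≥ 0`. [folklore] -/
theorem beta_abs_le (j : ℕ) : |D.beta j| ≤ B := by
  rw [abs_of_nonneg (hG.beta_nonneg j)]
  exact hG.beta_le j

/-! ### The induction step -/

section Step

variable (hs : Small L γ A B M CS R g₀) {j : ℕ}
variable (hj : D.IndAt L γ (M1c M) (M2c M) (M3c L γ A B M) j)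
include hs hj

/-- `|Σ_j| ≤ ½` (from `|Σ_j| ≤ ½M₃Σχǧ² ≤ ½M₃C_Σg₀` and the smallness `M₃C_Σg₀ ≤ 1`).
[cite: BauerschmidtBrydgesSlade2015LogCorr, Lemma 8.3.3 (proof, |μ̌'_j| ≤ 2Π_j)] -/
theorem abs_sig_le_half : |D.sig L γ j| ≤ 1 / 2 := by
  have h1 := hj.sig_le
  have h2 := h.sum_chi_mul_sq_le hG j
  have h3 : 0 ≤ M3c L γ A B M := (M3c_ge h.γ_nonneg h.A_nonneg hG.B_nonneg h.M_nonneg).2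
  have h4 : M3c L γ A B M / 2 * ∑ i ∈ range j, D.chi (i + 1) * D.g (i + 1) ^ 2 ≤
      M3c L γ A B M / 2 * (CS * g₀) := mul_le_mul_of_nonneg_left h2 (by linarith)
  linarith [hs.sig_le]

omit hs hj in
/-- `μ̌'_j = Π_j(1 + Σ_j)`. [cite: BauerschmidtBrydgesSlade2015LogCorr, Lemma 8.3.3 (proof, definition of Σ_j)] -/
theorem dmu_eq_prodPi_mul : D.dmu j = D.prodPi L γ j * (1 + D.sig L γ j) := by
  have hP := (D.prodPi_pos hG h.L_pos h.γ_nonneg h.γ_le_one j).ne'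
  unfold sig
  field_simp
  ring

/-- **`|μ̌'_j| ≤ 2Π_j`** (indeed `½Π_j ≤ μ̌'_j ≤ (3/2)Π_j`). [cite: BauerschmidtBrydgesSlade2015LogCorr, Lemma 8.3.3 (proof, the display |μ̌'_j| ≤ 2Π_j)] -/
theorem dmu_mem : D.prodPi L γ j / 2 ≤ D.dmu j ∧ D.dmu j ≤ 3 / 2 * D.prodPi L γ j := by
  have hP := (D.prodPi_pos hG h.L_pos h.γ_nonneg h.γ_le_one j).le
  have hσ := abs_le.1 (h.abs_sig_le_half hG hs hj)
  rw [h.dmu_eq_prodPi_mul hG]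
  constructor <;> nlinarith

omit hj in
/-- `M₁χ_jΠ_jǧ_j² ≤ Π_j` (`χ_j ≤ 1`, `M₁ǧ_j² ≤ 4M₁g₀² ≤ 1`). [cite: BauerschmidtBrydgesSlade2015LogCorr, Lemma 8.3.3 (proof, "(M₁ḡ_j² + 2)Π_j ≤ O(Π_j)")] -/
theorem M1_mul_unit_le : M1c M * D.unit L γ j ≤ D.prodPi L γ j := by
  have hP := (D.prodPi_pos hG h.L_pos h.γ_nonneg h.γ_le_one j).le
  have hM1 : 0 ≤ M1c M := by linarith [(M1c_ge h.M_nonneg).1]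
  have hg2 : D.g j ^ 2 ≤ 4 * g₀ ^ 2 := by
    have := hG.le_two_mul j
    have := (hG.g_pos j).le
    nlinarith
  have h1 : D.unit L γ j ≤ D.prodPi L γ j * D.g j ^ 2 := by
    unfold unit
    have := h.chi_le_one j
    have := (h.chi_pos j).le
    nlinarith [mul_nonneg hP (sq_nonneg (D.g j))]
  calc M1c M * D.unit L γ j ≤ M1c M * (D.prodPi L γ j * D.g j ^ 2) :=
        mul_le_mul_of_nonneg_left h1 hM1
    _ = D.prodPi L γ j * (M1c M * D.g j ^ 2) := by ring
    _ ≤ D.prodPi L γ j * 1 := by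
        refine mul_le_mul_of_nonneg_left ?_ hP
        nlinarith [hs.sq_le]
    _ = D.prodPi L γ j := mul_one _

/-- `‖V̌'_j‖ ≤ 2Π_j`. [cite: BauerschmidtBrydgesSlade2015LogCorr, Lemma 8.3.3 (proof, "(M₁ḡ_j² + 2)Π_j")] -/
theorem nV_le : D.nV j ≤ 2 * D.prodPi L γ j := by
  have hP := (D.prodPi_pos hG h.L_pos h.γ_nonneg h.γ_le_one j).le
  have hMu := h.M1_mul_unit_le hG hs (j := j)
  have h1 : |D.dg j| ≤ 2 * D.prodPi L γ j := by linarith [hj.dg_le]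
  have h2 : |D.dz j| ≤ 2 * D.prodPi L γ j := by linarith [hj.dz_le]
  have h3 : |D.dmu j| ≤ 2 * D.prodPi L γ j := by
    obtain ⟨hlo, hhi⟩ := h.dmu_mem hG hs hj
    rw [abs_le]; constructor <;> linarith
  unfold nV
  exact max_le h1 (max_le h2 h3)

/-- The remainder contributions: **`|ρ^u_j| ≤ M₄χ_jΠ_jǧ_j²`** (`u = g, z, μ`), `M₄ = 2M + MM₂`
("`‖Ř'_{j+1}‖ ≤ O(M₂)χ_jΠ_jḡ_j²`"). [cite: BauerschmidtBrydgesSlade2015LogCorr, Lemma 8.3.3 (proof, the displays ‖D_VF V̌'_j‖ ≤ O(χ_jΠ_jḡ_j²), ‖D_KŘ K'_j‖ ≤ O(M₂)χ_jΠ_jḡ_j², ‖Ř'_{j+1}‖ ≤ O(M₂)χ_jΠ_jḡ_j²)] -/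
theorem rem_le :
    |D.rg j| ≤ M4c M * D.unit L γ j ∧ |D.rz j| ≤ M4c M * D.unit L γ j ∧
      |D.rmu j| ≤ M4c M * D.unit L γ j := by
  have hV := h.nV_le hG hs hj
  have hk := hj.k_le
  have hM := h.M_nonneg
  have hcg : 0 ≤ M * D.chi j * D.g j ^ 2 :=
    mul_nonneg (mul_nonneg hM (h.chi_pos j).le) (sq_nonneg _)
  have key : M * D.chi j * D.g j ^ 2 * D.nV j + M * D.k j ≤ M4c M * D.unit L γ j := by
    have h1 : M * D.chi j * D.g j ^ 2 * D.nV j ≤ M * D.chi j * D.g j ^ 2 * (2 * D.prodPi L γ j) :=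
      mul_le_mul_of_nonneg_left hV hcg
    have h2 : M * D.k j ≤ M * (M2c M * D.unit L γ j) := mul_le_mul_of_nonneg_left hk hM
    unfold M4c
    unfold unit at h2 ⊢
    nlinarith
  exact ⟨(h.rg_le j).trans key, (h.rz_le j).trans key, (h.rmu_le j).trans key⟩

/-- Advancing `ǧ'`: `|ǧ'_{j+1}| ≤ 2M₁χ_jΠ_jǧ_j² ≤ M₁χ_{j+1}Π_{j+1}ǧ_{j+1}²`.
[cite: BauerschmidtBrydgesSlade2015LogCorr, Lemma 8.3.3 (proof, the display |ǧ'_{j+1}|, |ž'_{j+1}| ≤ 2M₁χ_jΠ_jḡ_j² ≤ M₁χ_{j+1}Π_{j+1}ḡ_{j+1}²)] -/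
theorem dg_succ_le : |D.dg (j + 1)| ≤ M1c M * D.unit L γ (j + 1) := by
  obtain ⟨hrg, -, -⟩ := h.rem_le hG hs hj
  have hu := h.unit_nonneg hG j
  have hu1 := h.unit_succ_ge hG j
  obtain ⟨hb0, hb1⟩ := hG.beta_mul_mem j
  have hfac : |1 - 2 * D.beta j * D.g j| ≤ 1 := by
    rw [abs_le]; constructor <;> nlinarith
  have hM1 := M1c_ge h.M_nonneg
  have hM4 := M4c_nonneg h.M_nonneg
  rw [h.rec_g j]
  calc |(1 - 2 * D.beta j * D.g j) * D.dg j + D.rg j|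
      ≤ |(1 - 2 * D.beta j * D.g j) * D.dg j| + |D.rg j| := abs_add_le _ _
    _ ≤ 1 * (M1c M * D.unit L γ j) + M4c M * D.unit L γ j :=
        add_le_add (abs_mul_le_mul hfac hj.dg_le) hrg
    _ ≤ 2 * M1c M * D.unit L γ j := by nlinarith
    _ ≤ M1c M * D.unit L γ (j + 1) := by nlinarith

/-- Advancing `ž'`: `|ž'_{j+1}| ≤ M₁χ_{j+1}Π_{j+1}ǧ_{j+1}²`.
[cite: BauerschmidtBrydgesSlade2015LogCorr, Lemma 8.3.3 (proof, the display |ǧ'_{j+1}|, |ž'_{j+1}| ≤ 2M₁χ_jΠ_jḡ_j² ≤ M₁χ_{j+1}Π_{j+1}ḡ_{j+1}²)] -/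
theorem dz_succ_le : |D.dz (j + 1)| ≤ M1c M * D.unit L γ (j + 1) := by
  obtain ⟨-, hrz, -⟩ := h.rem_le hG hs hj
  have hu := h.unit_nonneg hG j
  have hu1 := h.unit_succ_ge hG j
  have hM1 := M1c_ge h.M_nonneg
  have hM4 := M4c_nonneg h.M_nonneg
  have hA := h.A_nonneg
  have hθ : |D.theta j| ≤ A := (h.theta_le j).trans (by nlinarith [h.chi_le_one j])
  have hg : |D.g j| ≤ 2 * g₀ := by
    rw [abs_of_nonneg (hG.g_pos j).le]; exact hG.le_two_mul j
  have hcross : |2 * D.theta j * D.g j * D.dg j| ≤ 2 * A * (2 * g₀) * (M1c M * D.unit L γ j) := by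
    have h2 : |(2 : ℝ)| ≤ 2 := by norm_num
    have := abs_mul_le_mul (abs_mul_mul_le h2 hθ hg) hj.dg_le
    simpa [mul_assoc] using this
  have hsmall : 2 * A * (2 * g₀) ≤ 1 / 2 := by linarith [hs.A_le]
  rw [h.rec_z j]
  calc |D.dz j - 2 * D.theta j * D.g j * D.dg j + D.rz j|
      ≤ |D.dz j| + |2 * D.theta j * D.g j * D.dg j| + |D.rz j| :=
        (abs_add_le _ _).trans (add_le_add (abs_sub _ _) le_rfl)
    _ ≤ M1c M * D.unit L γ j + 2 * A * (2 * g₀) * (M1c M * D.unit L γ j) + M4c M * D.unit L γ j :=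
        add_le_add (add_le_add hj.dz_le hcross) hrz
    _ ≤ 2 * M1c M * D.unit L γ j := by nlinarith [mul_nonneg (by linarith : (0:ℝ) ≤ M1c M) hu]
    _ ≤ M1c M * D.unit L γ (j + 1) := by nlinarith

/-- Advancing `k`: `k_{j+1} ≤ (2M + κM₂)χ_jΠ_jǧ_j² ≤ 2M₂χ_jΠ_jǧ_j² ≤ M₂χ_{j+1}Π_{j+1}ǧ_{j+1}²`
("`‖Ǩ'_{j+1}‖ ≤ 2M₂χ_jΠ_jḡ_j²`"). [cite: BauerschmidtBrydgesSlade2015LogCorr, Lemma 8.3.3 (proof, the display ‖Ǩ'_{j+1}(V̌_j,K_j)‖ ≤ 2M₂χ_jΠ_jḡ_j²)] -/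
theorem k_succ_le' : D.k (j + 1) ≤ M2c M * D.unit L γ (j + 1) := by
  have hV := h.nV_le hG hs hj
  have hk := hj.k_le
  have hM := h.M_nonneg
  have hu := h.unit_nonneg hG j
  have hu1 := h.unit_succ_ge hG j
  have hM2 := M2c_ge hM
  have hcg : 0 ≤ M * D.chi j * D.g j ^ 2 :=
    mul_nonneg (mul_nonneg hM (h.chi_pos j).le) (sq_nonneg _)
  have h1 : M * D.chi j * D.g j ^ 2 * D.nV j ≤ M * D.chi j * D.g j ^ 2 * (2 * D.prodPi L γ j) :=
    mul_le_mul_of_nonneg_left hV hcg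
  have h2 : κ * D.k j ≤ 1 * (M2c M * D.unit L γ j) :=
    mul_le_mul h.κ_le_one hk (h.k_nonneg j) zero_le_one
  have h3 : M * D.chi j * D.g j ^ 2 * (2 * D.prodPi L γ j) = 2 * M * D.unit L γ j := by
    unfold unit; ring
  calc D.k (j + 1) ≤ M * D.chi j * D.g j ^ 2 * D.nV j + κ * D.k j := h.k_succ_le j
    _ ≤ 2 * M * D.unit L γ j + M2c M * D.unit L γ j := by linarith
    _ ≤ 2 * M2c M * D.unit L γ j := by nlinarith
    _ ≤ M2c M * D.unit L γ (j + 1) := by nlinarith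

/-- The error term of the `μ̌`-row: `E_j = -L²γβ_jμ̌_jǧ'_j + η_jǧ'_j - 2ξ_jǧ_jǧ'_j - π_j(ǧ'_jž_j + ǧ_jž'_j) + ρ^μ_j`
satisfies **`|E_j| ≤ M₃χ_jΠ_jǧ_j²`** ("`O((M₁+M₂)χ_jΠ_jḡ_j²)`"). [cite: BauerschmidtBrydgesSlade2015LogCorr, Lemma 8.3.3 (proof, the display μ̌'_{j+1} = L²μ̌'_j(1 - γβ_jǧ_j) + O((M₁+M₂)χ_jΠ_jḡ_j²))] -/
theorem abs_err_le :
    |(-(L ^ 2 * γ * D.beta j * D.mu j * D.dg j) + D.eta j * D.dg j - 2 * D.xi j * D.g j * D.dg j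
        - D.pic j * (D.dg j * D.z j + D.g j * D.dz j) + D.rmu j)| ≤
      M3c L γ A B M * D.unit L γ j := by
  obtain ⟨-, -, hrmu⟩ := h.rem_le hG hs hj
  have hu := h.unit_nonneg hG j
  have hA := h.A_nonneg
  have hγ := h.γ_nonneg
  have hB := hG.B_nonneg
  have hχ1 := h.chi_le_one j
  have hχ0 := (h.chi_pos j).le
  have hg1 := hG.g_le_one j
  have hg0 := (hG.g_pos j).le
  set U : ℝ := M1c M * D.unit L γ j with hU
  have hU0 : 0 ≤ U := mul_nonneg (by linarith [(M1c_ge h.M_nonneg).1]) hu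
  -- one-factor bounds
  have hβ : |D.beta j| ≤ B := beta_abs_le hG j
  have hχg : D.chi j * D.g j ≤ 1 := mul_le_one₀ hχ1 hg0 hg1
  have hAχg : A * D.chi j * D.g j ≤ A := by
    have h1 := mul_le_mul_of_nonneg_left hχg hA
    rw [mul_one] at h1
    linarith [h1, mul_assoc A (D.chi j) (D.g j)]
  have hμ : |D.mu j| ≤ A := (h.mu_le j).trans hAχg
  have hz : |D.z j| ≤ A := (h.z_le j).trans hAχg
  have hη : |D.eta j| ≤ A := (h.eta_le j).trans (by nlinarith)
  have hξ : |D.xi j| ≤ A := (h.xi_le j).trans (by nlinarith)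
  have hπ : |D.pic j| ≤ A := (h.pic_le j).trans (by nlinarith)
  have hg : |D.g j| ≤ 1 := by rw [abs_of_nonneg hg0]; exact hg1
  have hdg : |D.dg j| ≤ U := hj.dg_le
  have hdz : |D.dz j| ≤ U := hj.dz_le
  have hL2γ : |L ^ 2 * γ| ≤ L ^ 2 * γ := by
    rw [abs_of_nonneg (mul_nonneg (sq_nonneg L) hγ)]
  -- the five terms
  have t1 : |L ^ 2 * γ * D.beta j * D.mu j * D.dg j| ≤ L ^ 2 * γ * B * A * U := by
    have := abs_mul_le_mul (abs_mul_le_mul (abs_mul_mul_le hL2γ hβ hμ) hdg) (le_refl |(1:ℝ)|)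
    simp only [abs_one, mul_one] at this
    simpa [mul_assoc] using this
  have t2 : |D.eta j * D.dg j| ≤ A * U := abs_mul_le_mul hη hdg
  have t3 : |2 * D.xi j * D.g j * D.dg j| ≤ 2 * A * 1 * U := by
    have h2 : |(2 : ℝ)| ≤ 2 := by norm_num
    exact abs_mul_le_mul (abs_mul_mul_le h2 hξ hg) hdg
  have t4 : |D.pic j * (D.dg j * D.z j + D.g j * D.dz j)| ≤ A * (U * A + 1 * U) := by
    refine abs_mul_le_mul hπ ((abs_add_le _ _).trans (add_le_add ?_ ?_))
    · exact abs_mul_le_mul hdg hz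
    · exact abs_mul_le_mul hg hdz
  have t5 : |D.rmu j| ≤ M4c M * D.unit L γ j := hrmu
  have hsum := calc
    |(-(L ^ 2 * γ * D.beta j * D.mu j * D.dg j) + D.eta j * D.dg j - 2 * D.xi j * D.g j * D.dg j
        - D.pic j * (D.dg j * D.z j + D.g j * D.dz j) + D.rmu j)|
        ≤ |(-(L ^ 2 * γ * D.beta j * D.mu j * D.dg j))| + |D.eta j * D.dg j|
          + |2 * D.xi j * D.g j * D.dg j| + |D.pic j * (D.dg j * D.z j + D.g j * D.dz j)|
          + |D.rmu j| := by
          refine (abs_add_le _ _).trans (add_le_add ?_ le_rfl)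
          refine (abs_sub _ _).trans (add_le_add ?_ le_rfl)
          refine (abs_sub _ _).trans (add_le_add ?_ le_rfl)
          exact abs_add_le _ _
    _ ≤ L ^ 2 * γ * B * A * U + A * U + 2 * A * 1 * U + A * (U * A + 1 * U)
          + M4c M * D.unit L γ j := by
          rw [abs_neg]
          exact add_le_add (add_le_add (add_le_add (add_le_add t1 t2) t3) t4) t5
  refine hsum.trans (le_of_eq ?_)
  rw [hU]
  unfold M3c
  ring

/-- Advancing `μ̌'`: `μ̌'_{j+1} = Π_{j+1}(1 + Σ_j) + E_j`, so **`|Σ_{j+1} - Σ_j| = |E_j|/Π_{j+1} ≤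
½M₃χ_{j+1}ǧ_{j+1}²`**. [cite: BauerschmidtBrydgesSlade2015LogCorr, Lemma 8.3.3 (proof, the display μ̌'_{j+1} = Π_{j+1}(1+Σ_j) + O((M₁+M₂)χ_{j+1}Π_{j+1}ḡ_{j+1}²))] -/
theorem abs_sig_succ_sub_le' :
    |D.sig L γ (j + 1) - D.sig L γ j| ≤ M3c L γ A B M / 2 * (D.chi (j + 1) * D.g (j + 1) ^ 2) := by
  have hE := h.abs_err_le hG hs hj
  have hP1 := D.prodPi_pos hG h.L_pos h.γ_nonneg h.γ_le_one (j + 1)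
  have hdmu := h.dmu_eq_prodPi_mul hG (j := j)
  have hu1 := h.unit_succ_ge hG j
  have hM3 : 0 ≤ M3c L γ A B M := (M3c_ge h.γ_nonneg h.A_nonneg hG.B_nonneg h.M_nonneg).2
  set E : ℝ := -(L ^ 2 * γ * D.beta j * D.mu j * D.dg j) + D.eta j * D.dg j
      - 2 * D.xi j * D.g j * D.dg j - D.pic j * (D.dg j * D.z j + D.g j * D.dz j) + D.rmu j with hEdef
  have hP0 := (D.prodPi_pos hG h.L_pos h.γ_nonneg h.γ_le_one j).ne'
  -- `μ̌'_{j+1} = Π_{j+1}(1 + Σ_j) + E_j`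
  have hrec : D.dmu (j + 1) = D.prodPi L γ (j + 1) * (1 + D.sig L γ j) + E := by
    have e1 : D.prodPi L γ (j + 1) * (1 + D.sig L γ j) =
        L ^ 2 * (1 - γ * (D.beta j * D.g j)) * D.dmu j := by
      rw [D.prodPi_succ, hdmu]
      ring
    rw [e1, h.rec_mu j, hEdef]
    ring
  have hdiff : D.sig L γ (j + 1) - D.sig L γ j = E / D.prodPi L γ (j + 1) := by
    unfold sig
    rw [hrec]
    unfold sig
    field_simp
    ring
  rw [hdiff, abs_div, abs_of_pos hP1, div_le_iff₀ hP1]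
  calc |E| ≤ M3c L γ A B M * D.unit L γ j := hE
    _ ≤ M3c L γ A B M * (D.unit L γ (j + 1) / 2) := mul_le_mul_of_nonneg_left (by linarith) hM3
    _ = M3c L γ A B M / 2 * (D.chi (j + 1) * D.g (j + 1) ^ 2) * D.prodPi L γ (j + 1) := by
        unfold unit; ring

/-- **The induction step**: (induct1) at `j` implies (induct1) at `j + 1`.
[cite: BauerschmidtBrydgesSlade2015LogCorr, Lemma 8.3.3 (proof, "This advances the induction")] -/
theorem indAt_succ : D.IndAt L γ (M1c M) (M2c M) (M3c L γ A B M) (j + 1) where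
  dg_le := h.dg_succ_le hG hs hj
  dz_le := h.dz_succ_le hG hs hj
  k_le := h.k_succ_le' hG hs hj
  sig_le := by
    have h1 := h.abs_sig_succ_sub_le' hG hs hj
    have h2 := hj.sig_le
    rw [sum_range_succ, mul_add]
    calc |D.sig L γ (j + 1)| = |D.sig L γ j + (D.sig L γ (j + 1) - D.sig L γ j)| := by ring_nf
      _ ≤ |D.sig L γ j| + |D.sig L γ (j + 1) - D.sig L γ j| := abs_add_le _ _
      _ ≤ _ := add_le_add h2 h1

end Step

/-! ### The induction -/

/-- (induct1) holds at `j = 0`: "Since `(ǧ₀',ž₀',μ̌₀',K₀') = (0,0,1,0)`, the inductive assumption is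
true for `j = 0`" (`Σ₀ = 0`). [cite: BauerschmidtBrydgesSlade2015LogCorr, Lemma 8.3.3 (proof, base of the induction)] -/
theorem indAt_zero : D.IndAt L γ (M1c M) (M2c M) (M3c L γ A B M) 0 where
  dg_le := by
    rw [h.dg_zero, abs_zero]
    exact mul_nonneg (by linarith [(M1c_ge h.M_nonneg).1]) (h.unit_nonneg hG 0)
  dz_le := by
    rw [h.dz_zero, abs_zero]
    exact mul_nonneg (by linarith [(M1c_ge h.M_nonneg).1]) (h.unit_nonneg hG 0)
  k_le := by
    rw [h.k_zero]
    exact mul_nonneg (by linarith [(M2c_ge h.M_nonneg).1]) (h.unit_nonneg hG 0)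
  sig_le := by
    simp [sig, h.dmu_zero, prodPi]

/-- **The inductive bounds (induct1) hold for all `j`** (`g₀` small as in `Small`).
[cite: BauerschmidtBrydgesSlade2015LogCorr, Lemma 8.3.3 (proof, "having established that (induct1) holds for all j")] -/
theorem inductive_bounds (hs : Small L γ A B M CS R g₀) (j : ℕ) :
    D.IndAt L γ (M1c M) (M2c M) (M3c L γ A B M) j := by
  induction j with
  | zero => exact h.indAt_zero hG
  | succ j ih => exact h.indAt_succ hG hs ih

/-- **`|Σ_{j+1} - Σ_j| ≤ ½M₃χ_{j+1}ǧ_{j+1}²`** for all `j` ("`|Σ_j - Σ_{j-1}| ≤ O(M₁+M₂)χ_jḡ_j²`").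
[cite: BauerschmidtBrydgesSlade2015LogCorr, Lemma 8.3.3 (proof, (induct1), first estimate)] -/
theorem abs_sig_succ_sub_le (hs : Small L γ A B M CS R g₀) (j : ℕ) :
    |D.sig L γ (j + 1) - D.sig L γ j| ≤ M3c L γ A B M / 2 * (D.chi (j + 1) * D.g (j + 1) ^ 2) :=
  h.abs_sig_succ_sub_le' hG hs (h.inductive_bounds hG hs j)

/-- **`|μ̌'_j| ≤ 2Π_j`**, indeed `½Π_j ≤ μ̌'_j ≤ (3/2)Π_j`, for all `j`.
[cite: BauerschmidtBrydgesSlade2015LogCorr, Lemma 8.3.3 (proof, the display |μ̌'_j| ≤ 2Π_j)] -/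
theorem dmu_mem_all (hs : Small L γ A B M CS R g₀) (j : ℕ) :
    D.prodPi L γ j / 2 ≤ D.dmu j ∧ D.dmu j ≤ 3 / 2 * D.prodPi L γ j :=
  h.dmu_mem hG hs (h.inductive_bounds hG hs j)

/-! ### `Σ_∞ = lim Σ_j`, "`Σ_∞ = O(g₀)`", "`Σ_∞ - Σ_j = O(χ_jḡ_j)`" -/

section Limit

variable (hs : Small L γ A B M CS R g₀)
include hs

omit hG hs in
/-- `Σ₀ = 0` (`μ̌₀' = 1 = Π₀`). [cite: BauerschmidtBrydgesSlade2015LogCorr, Lemma 8.3.3 (proof, Σ_{-1} = 0, μ̌₀' = 1)] -/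
theorem sig_zero : D.sig L γ 0 = 0 := by
  simp [sig, h.dmu_zero]

omit hG hs in
/-- `Σ_j = Σ_{i<j}(Σ_{i+1} - Σ_i)` (telescoping). [folklore] -/
theorem sig_eq_sum_range (j : ℕ) :
    D.sig L γ j = ∑ i ∈ range j, (D.sig L γ (i + 1) - D.sig L γ i) := by
  rw [Finset.sum_range_sub, h.sig_zero, sub_zero]

/-- The increments `Σ_{j+1} - Σ_j` are absolutely summable (`≤ ½M₃χ_{j+1}ǧ_{j+1}²`).
[cite: BauerschmidtBrydgesSlade2015LogCorr, Lemma 8.3.3 (proof, "Since Σ_{j≥1}χ_jḡ_j² = O(g₀) … the limit Σ_∞ … exists")] -/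
theorem summable_sig_sub : Summable fun j => D.sig L γ (j + 1) - D.sig L γ j := by
  refine Summable.of_norm_bounded
    ((((summable_nat_add_iff 1).2 h.summable).mul_left (M3c L γ A B M / 2))) fun j => ?_
  rw [Real.norm_eq_abs]
  exact h.abs_sig_succ_sub_le hG hs j

/-- **`Σ_j → Σ_∞`**. [cite: BauerschmidtBrydgesSlade2015LogCorr, Lemma 8.3.3 (proof, "the limit Σ_∞ = lim_{j→∞}Σ_j exists")] -/
theorem tendsto_sig : Tendsto (fun j => D.sig L γ j) atTop (𝓝 (D.sigLim L γ)) := by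
  have hT := (h.summable_sig_sub hG hs).hasSum.tendsto_sum_nat
  refine hT.congr fun j => ?_
  exact (h.sig_eq_sum_range j).symm

/-- **`|Σ_∞| ≤ ½M₃C_Σg₀`** ("`Σ_∞ = O(g₀)`"). [cite: BauerschmidtBrydgesSlade2015LogCorr, Lemma 8.3.3 (proof, "Σ_∞ = O(g₀)")] -/
theorem abs_sigLim_le : |D.sigLim L γ| ≤ M3c L γ A B M / 2 * (CS * g₀) := by
  refine le_of_tendsto ((continuous_abs.tendsto _).comp (h.tendsto_sig hG hs))
    (Eventually.of_forall fun j => ?_)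
  have h1 := (h.inductive_bounds hG hs j).sig_le
  have h2 := h.sum_chi_mul_sq_le hG j
  have h3 : 0 ≤ M3c L γ A B M := (M3c_ge h.γ_nonneg h.A_nonneg hG.B_nonneg h.M_nonneg).2
  exact h1.trans (mul_le_mul_of_nonneg_left h2 (by linarith))

/-- **`|Σ_∞ - Σ_j| ≤ ½M₃C_Σχ_{j+1}ǧ_{j+1}`** (the tail of the increments and the tail bound (chigbd-bis)).
[cite: BauerschmidtBrydgesSlade2015LogCorr, Lemma 8.3.3 (proof, "Σ_∞ - Σ_j = O(Σ_{k>j}χ_kḡ_k²) = O(χ_jḡ_j)")] -/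
theorem abs_sigLim_sub_le (j : ℕ) :
    |D.sigLim L γ - D.sig L γ j| ≤ M3c L γ A B M / 2 * (CS * D.chi (j + 1) * D.g (j + 1)) := by
  have hsum := h.summable_sig_sub hG hs
  have hM3 : 0 ≤ M3c L γ A B M := (M3c_ge h.γ_nonneg h.A_nonneg hG.B_nonneg h.M_nonneg).2
  set f : ℕ → ℝ := fun i => D.sig L γ (i + 1) - D.sig L γ i with hf
  -- `Σ_∞ - Σ_j = Σ_{i≥0} f(i+j)`
  have htail : D.sigLim L γ - D.sig L γ j = ∑' i, f (i + j) := by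
    have h1 := hsum.sum_add_tsum_nat_add j
    rw [← h.sig_eq_sum_range j] at h1
    unfold sigLim
    linarith
  -- bound termwise by `b_i = ½M₃χ_{i+j+1}ǧ_{i+j+1}²`
  set b : ℕ → ℝ := fun i => M3c L γ A B M / 2 * (D.chi (i + (j + 1)) * D.g (i + (j + 1)) ^ 2) with hb
  have hfb : ∀ i, |f (i + j)| ≤ b i := fun i => h.abs_sig_succ_sub_le hG hs (i + j)
  have hbs : Summable b := ((summable_nat_add_iff (j + 1)).2 h.summable).mul_left _
  have hfs : Summable fun i => |f (i + j)| :=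
    Summable.of_nonneg_of_le (fun i => abs_nonneg _) hfb hbs
  have h2 : |∑' i, f (i + j)| ≤ ∑' i, |f (i + j)| := by
    have := norm_tsum_le_tsum_norm (f := fun i => f (i + j)) (by simpa [Real.norm_eq_abs] using hfs)
    simpa [Real.norm_eq_abs] using this
  have h3 : ∑' i, |f (i + j)| ≤ ∑' i, b i := hfs.tsum_le_tsum hfb hbs
  have h4 : ∑' i, b i = M3c L γ A B M / 2 * ∑' i, D.chi (i + (j + 1)) * D.g (i + (j + 1)) ^ 2 :=
    tsum_mul_left
  have h5 := h.tail_le (j + 1)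
  rw [htail]
  calc |∑' i, f (i + j)| ≤ ∑' i, b i := h2.trans h3
    _ ≤ M3c L γ A B M / 2 * (CS * D.chi (j + 1) * D.g (j + 1)) := by
        rw [h4]; exact mul_le_mul_of_nonneg_left h5 (by linarith)

omit h hs in
/-- `ǧ_{j+1} ≤ 2ǧ_j` (indeed `≤ ǧ_j + ¼ǧ_j²`). [folklore] -/
theorem g_succ_le_two_mul (j : ℕ) : D.g (j + 1) ≤ 2 * D.g j := by
  have h1 := hG.g_succ_le j
  have h2 := hG.abs_rem_le j
  have h3 := hG.g_le_one j
  have h4 := (hG.g_pos j).le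
  nlinarith

/-- **`|Σ_∞ - Σ_j| ≤ M₃C_Σχ_jǧ_j`** ("`Σ_∞ - Σ_j = O(χ_jḡ_j)`"; `χ_{j+1} ≤ χ_j`, `ǧ_{j+1} ≤ 2ǧ_j`).
[cite: BauerschmidtBrydgesSlade2015LogCorr, Lemma 8.3.3 (proof, "Σ_∞ - Σ_j = O(χ_jḡ_j)")] -/
theorem abs_sigLim_sub_le' (j : ℕ) :
    |D.sigLim L γ - D.sig L γ j| ≤ M3c L γ A B M * CS * D.chi j * D.g j := by
  have h1 := h.abs_sigLim_sub_le hG hs j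
  have hM3 : 0 ≤ M3c L γ A B M := (M3c_ge h.γ_nonneg h.A_nonneg hG.B_nonneg h.M_nonneg).2
  have hχ := h.chi_succ_le j
  have hχ0 := (h.chi_pos (j + 1)).le
  have hg := g_succ_le_two_mul hG j
  have hg0 := (hG.g_pos (j + 1)).le
  have h2 : D.chi (j + 1) * D.g (j + 1) ≤ D.chi j * (2 * D.g j) :=
    mul_le_mul hχ hg hg0 (h.chi_pos j).le
  have h3 : M3c L γ A B M / 2 * (CS * D.chi (j + 1) * D.g (j + 1)) ≤
      M3c L γ A B M / 2 * (CS * (D.chi j * (2 * D.g j))) := by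
    refine mul_le_mul_of_nonneg_left ?_ (by linarith)
    have := mul_le_mul_of_nonneg_left h2 h.CS_nonneg
    linarith [mul_assoc CS (D.chi (j + 1)) (D.g (j + 1))]
  refine h1.trans (h3.trans (le_of_eq ?_))
  ring

/-! ### The product formula: `Π_j = L^{2j}(ǧ_j/g₀)^γ/P_j`, and the tails of `log P` -/

omit hs in
/-- **`Π_j = L^{2j}(ǧ_j/g₀)^γ/P_j`** from the product formula `∏_{k<j}(1 - γβ_kǧ_k)⁻¹ = (g₀/ǧ_j)^γP_j`
of `WeaklySAWCouplingFlowProductRemainder.lean` ("`Π_j = L^{2j}(ǧ_j/ǧ₀)^γ(1 + Γ_∞ + O(χ_jǧ_j))`").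
[cite: BauerschmidtBrydgesSlade2015LogCorr, Lemma 8.3.3 (proof, the display Π_j = L^{2j}(ǧ_j/ǧ₀)^γ(1 + Γ_∞(m²,g₀) + O(χ_jǧ_j)))] -/
theorem prodPi_eq (j : ℕ) :
    D.prodPi L γ j = L ^ (2 * j) * ((D.g j / g₀) ^ γ / prodFactorR D.beta D.g γ j) := by
  have hγ1 := h.γ_le_one
  have hprod := hG.prod_inv_one_sub_eq hγ1 j
  have hP := hG.prodFactorR_pos hγ1 j
  have hgj := hG.g_pos j
  have hq : 0 < g₀ / D.g j := div_pos hG.pos₀ hgj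
  have hr : 0 < (g₀ / D.g j) ^ γ := Real.rpow_pos_of_pos hq γ
  unfold prodPi
  congr 1
  rw [prod_inv_distrib] at hprod
  have h1 : ∏ l ∈ range j, (1 - γ * (D.beta l * D.g l)) = ((g₀ / D.g j) ^ γ * prodFactorR D.beta D.g γ j)⁻¹ := by
    rw [← hprod, inv_inv]
  rw [h1, mul_inv, ← Real.inv_rpow hq.le, inv_div]
  ring

omit hs in
/-- The majorant of `|log F_k|` in the present weights: `|log F_k| ≤ (32γB²/9 + 4R)χ_kǧ_k²`
(`t_k = β_kǧ_k ≤ Bχ_kǧ_k`, `|s_k| ≤ ρ_kǧ_k ≤ Rχ_kǧ_k²`). [cite: BauerschmidtBrydgesSlade2015Flow, Lemma 2.1 (proof of (iii-a), |log(1+r_k)| ≤ O(t_k² + |s_k|))] -/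
theorem abs_log_stepFactorR_le' (hρR : ∀ j, ρ j ≤ R * D.chi j * D.g j) (k : ℕ) :
    |Real.log (stepFactorR γ (D.beta k * D.g k) (flowRem D.beta D.g k / D.g k))| ≤
      (32 / 9 * γ * B ^ 2 + 4 * R) * (D.chi k * D.g k ^ 2) := by
  have h1 := hG.abs_log_stepFactorR_le h.γ_nonneg h.γ_le_one k
  have hs1 := hG.abs_s_le k
  have hχ0 := (h.chi_pos k).le
  have hχ1 := h.chi_le_one k
  have hg0 := (hG.g_pos k).le
  have hβ0 := hG.beta_nonneg k
  have hβ := h.beta_le_chi k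
  have hB := hG.B_nonneg
  -- `t_k² ≤ B²χ_kǧ_k²`
  have ht : (D.beta k * D.g k) ^ 2 ≤ B ^ 2 * (D.chi k * D.g k ^ 2) := by
    have h2 : D.beta k * D.g k ≤ B * D.chi k * D.g k := by nlinarith
    have h3 : 0 ≤ D.beta k * D.g k := mul_nonneg hβ0 hg0
    have h4 : (D.beta k * D.g k) ^ 2 ≤ (B * D.chi k * D.g k) ^ 2 := pow_le_pow_left₀ h3 h2 2
    have h5 : (B * D.chi k * D.g k) ^ 2 ≤ B ^ 2 * (D.chi k * D.g k ^ 2) := by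
      have : D.chi k ^ 2 ≤ D.chi k := by nlinarith
      nlinarith [mul_nonneg (sq_nonneg B) (sq_nonneg (D.g k))]
    exact h4.trans h5
  -- `|s_k| ≤ Rχ_kǧ_k²`
  have hsk : |flowRem D.beta D.g k / D.g k| ≤ R * (D.chi k * D.g k ^ 2) := by
    refine hs1.trans ?_
    have := mul_le_mul_of_nonneg_right (hρR k) hg0
    nlinarith
  have hγ := h.γ_nonneg
  nlinarith [mul_le_mul_of_nonneg_left ht (by positivity : (0:ℝ) ≤ 32 / 9 * γ)]

omit hs in
/-- `Σ_k|log F_k| < ∞` under the present hypotheses (massless case included: `Σχ_kǧ_k² < ∞`).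
[cite: BauerschmidtBrydgesSlade2015Flow, Lemma 2.1(iii)(a) (Σ_k log(1 + r_k) converges)] -/
theorem summable_log_stepFactorR' (hρR : ∀ j, ρ j ≤ R * D.chi j * D.g j) :
    Summable fun k => Real.log (stepFactorR γ (D.beta k * D.g k) (flowRem D.beta D.g k / D.g k)) :=
  Summable.of_norm_bounded (h.summable.mul_left _) fun k => by
    rw [Real.norm_eq_abs]; exact h.abs_log_stepFactorR_le' hG hρR k

omit hs in
/-- The tails: **`Σ_{k≥n}|log F_k| ≤ Wχ_nǧ_n`**, `W = (32γB²/9 + 4R)C_Σ`.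
[cite: BauerschmidtBrydgesSlade2015LogCorr, Lemma 8.3.3 (proof, the product formula "(c_j + O(χ_lḡ_l))")] -/
theorem tsum_abs_log_tail_le (hR : 0 ≤ R) (hρR : ∀ j, ρ j ≤ R * D.chi j * D.g j) (n : ℕ) :
    ∑' k, |Real.log (stepFactorR γ (D.beta (k + n) * D.g (k + n))
        (flowRem D.beta D.g (k + n) / D.g (k + n)))| ≤ Wc γ B R CS * D.chi n * D.g n := by
  set c : ℝ := 32 / 9 * γ * B ^ 2 + 4 * R with hc
  have hc0 : 0 ≤ c := by rw [hc]; have := h.γ_nonneg; positivity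
  have hb : ∀ k, |Real.log (stepFactorR γ (D.beta (k + n) * D.g (k + n))
      (flowRem D.beta D.g (k + n) / D.g (k + n)))| ≤ c * (D.chi (k + n) * D.g (k + n) ^ 2) :=
    fun k => h.abs_log_stepFactorR_le' hG hρR (k + n)
  have hbs : Summable fun k => c * (D.chi (k + n) * D.g (k + n) ^ 2) :=
    ((summable_nat_add_iff n).2 h.summable).mul_left c
  have has : Summable fun k => |Real.log (stepFactorR γ (D.beta (k + n) * D.g (k + n))
      (flowRem D.beta D.g (k + n) / D.g (k + n)))| :=
    Summable.of_nonneg_of_le (fun k => abs_nonneg _) hb hbs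
  calc _ ≤ ∑' k, c * (D.chi (k + n) * D.g (k + n) ^ 2) := has.tsum_le_tsum hb hbs
    _ = c * ∑' k, D.chi (k + n) * D.g (k + n) ^ 2 := tsum_mul_left
    _ ≤ c * (CS * D.chi n * D.g n) := mul_le_mul_of_nonneg_left (h.tail_le n) hc0
    _ = Wc γ B R CS * D.chi n * D.g n := by rw [hc]; unfold Wc; ring

omit hs in
/-- `|Σ_{k≥0} log F_k - Σ_{k<n} log F_k| ≤ Wχ_nǧ_n`, i.e. **`|log(P_∞/P_n)| ≤ Wχ_nǧ_n`**.
[cite: BauerschmidtBrydgesSlade2015LogCorr, Lemma 8.3.3 (proof, the product formula with error O(χ_lḡ_l))] -/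
theorem abs_tsum_log_sub_sum_le (hR : 0 ≤ R) (hρR : ∀ j, ρ j ≤ R * D.chi j * D.g j) (n : ℕ) :
    |(∑' k, Real.log (stepFactorR γ (D.beta k * D.g k) (flowRem D.beta D.g k / D.g k))) -
        ∑ k ∈ range n, Real.log (stepFactorR γ (D.beta k * D.g k) (flowRem D.beta D.g k / D.g k))| ≤
      Wc γ B R CS * D.chi n * D.g n := by
  set F : ℕ → ℝ := fun k => Real.log (stepFactorR γ (D.beta k * D.g k) (flowRem D.beta D.g k / D.g k))
    with hF
  have hsum := h.summable_log_stepFactorR' hG hρR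
  have h1 := hsum.sum_add_tsum_nat_add n
  have h2 : (∑' k, F k) - ∑ k ∈ range n, F k = ∑' k, F (k + n) := by
    simp only [hF] at h1 ⊢; linarith
  rw [h2]
  have h3 := h.tsum_abs_log_tail_le hG hR hρR n
  have has : Summable fun k => ‖F (k + n)‖ := by
    simpa [Real.norm_eq_abs] using (summable_nat_add_iff n).2 hsum.abs
  have h4 := norm_tsum_le_tsum_norm has
  simp only [Real.norm_eq_abs] at h4
  exact h4.trans h3

omit hs in
/-- `P_∞/P_n = exp(Σ_{k≥n} log F_k)`: **`|P_∞/P_n - 1| ≤ 2Wχ_nǧ_n`** whenever `Wχ_nǧ_n ≤ 1`.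
[cite: BauerschmidtBrydgesSlade2015LogCorr, Lemma 8.3.3 (proof, the product formula "(c_j + O(χ_lḡ_l))")] -/
theorem abs_prodFactorRLim_div_sub_one_le (hR : 0 ≤ R) (hρR : ∀ j, ρ j ≤ R * D.chi j * D.g j)
    (n : ℕ) (hn : Wc γ B R CS * D.chi n * D.g n ≤ 1) :
    |prodFactorRLim D.beta D.g γ / prodFactorR D.beta D.g γ n - 1| ≤
      2 * (Wc γ B R CS * D.chi n * D.g n) := by
  have h1 := h.abs_tsum_log_sub_sum_le hG hR hρR n
  rw [prodFactorRLim, hG.prodFactorR_eq_exp_sum h.γ_le_one n, ← Real.exp_sub]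
  refine (Real.abs_exp_sub_one_le (h1.trans hn)).trans ?_
  linarith

omit hs in
/-- `|Σ_k log F_k| ≤ Wg₀`, hence **`|P_∞ - 1| ≤ 2Wg₀`** and **`P_∞ ≥ 1 - Wg₀`** ("`c = 1 + O(g₀)`" for the
product formula, i.e. `Γ_∞ = O(g₀)`), when `Wg₀ ≤ 1`. [cite: BauerschmidtBrydgesSlade2015LogCorr, Lemma 8.3.3 (proof, "a continuous function Γ_∞(m²,g₀) = O(g₀)")] -/
theorem prodFactorRLim_bounds (hR : 0 ≤ R) (hρR : ∀ j, ρ j ≤ R * D.chi j * D.g j)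
    (hW : Wc γ B R CS * g₀ ≤ 1) :
    |prodFactorRLim D.beta D.g γ - 1| ≤ 2 * (Wc γ B R CS * g₀) ∧
      1 - Wc γ B R CS * g₀ ≤ prodFactorRLim D.beta D.g γ := by
  have h1 := h.abs_tsum_log_sub_sum_le hG hR hρR 0
  simp only [range_zero, sum_empty, sub_zero] at h1
  have h2 : Wc γ B R CS * D.chi 0 * D.g 0 ≤ Wc γ B R CS * g₀ := by
    rw [hG.init]
    have hW0 := Wc_nonneg (B := B) h.γ_nonneg hR h.CS_nonneg
    have h3 : 0 ≤ Wc γ B R CS * g₀ * (1 - D.chi 0) :=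
      mul_nonneg (mul_nonneg hW0 hG.pos₀.le) (sub_nonneg.2 (h.chi_le_one 0))
    nlinarith
  have h3 := h1.trans h2
  refine ⟨?_, ?_⟩
  · rw [prodFactorRLim]
    exact (Real.abs_exp_sub_one_le (h3.trans hW)).trans (by linarith)
  · rw [prodFactorRLim]
    have h4 := (abs_le.1 h3).1
    linarith [Real.add_one_le_exp (∑' k, Real.log (stepFactorR γ (D.beta k * D.g k)
      (flowRem D.beta D.g k / D.g k)))]

omit hs in
/-- `P_n ≥ 1 - Wg₀` for all `n` (`log P_n ≥ -Σ_k|log F_k| ≥ -Wg₀`). [folklore] -/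
theorem prodFactorR_ge (hR : 0 ≤ R) (hρR : ∀ j, ρ j ≤ R * D.chi j * D.g j) (n : ℕ) :
    1 - Wc γ B R CS * g₀ ≤ prodFactorR D.beta D.g γ n := by
  set F : ℕ → ℝ := fun k => Real.log (stepFactorR γ (D.beta k * D.g k) (flowRem D.beta D.g k / D.g k))
    with hF
  have hsum := h.summable_log_stepFactorR' hG hρR
  have htail := h.tsum_abs_log_tail_le hG hR hρR 0
  simp only [add_zero] at htail
  have h2 : Wc γ B R CS * D.chi 0 * D.g 0 ≤ Wc γ B R CS * g₀ := by
    rw [hG.init]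
    have hW0 := Wc_nonneg (B := B) h.γ_nonneg hR h.CS_nonneg
    have h3 : 0 ≤ Wc γ B R CS * g₀ * (1 - D.chi 0) :=
      mul_nonneg (mul_nonneg hW0 hG.pos₀.le) (sub_nonneg.2 (h.chi_le_one 0))
    nlinarith
  have h1 : -(Wc γ B R CS * g₀) ≤ ∑ k ∈ range n, F k := by
    have h4 : ∑ k ∈ range n, |F k| ≤ ∑' k, |F k| :=
      hsum.abs.sum_le_tsum (range n) fun k _ => abs_nonneg _
    have h5 : -(∑ k ∈ range n, |F k|) ≤ ∑ k ∈ range n, F k := by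
      rw [← sum_neg_distrib]
      exact sum_le_sum fun k _ => neg_abs_le _
    simp only [hF] at h4 h5 htail ⊢
    linarith
  rw [hG.prodFactorR_eq_exp_sum h.γ_le_one n]
  linarith [Real.add_one_le_exp (∑ k ∈ range n, F k)]

/-! ### Lemma 8.3.3: the displays (mugzprime) and (Kprime) -/

omit hs in
/-- **`μ̌'_j = L^{2j}(ǧ_j/g₀)^γ(1 + Σ_j)/P_j`** EXACTLY (product formula inserted in `μ̌'_j = Π_j(1+Σ_j)`).
[cite: BauerschmidtBrydgesSlade2015LogCorr, Lemma 8.3.3 (proof, "From (prodid)–(muPiSig) and (sumid), we obtain the equation for μ̌'_j")] -/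
theorem dmu_eq (j : ℕ) :
    D.dmu j = L ^ (2 * j) * (D.g j / g₀) ^ γ * ((1 + D.sig L γ j) / prodFactorR D.beta D.g γ j) := by
  rw [h.dmu_eq_prodPi_mul hG (j := j), h.prodPi_eq hG j]
  ring

omit hs in
/-- The normalised derivative: **`μ̌'_j/(L^{2j}(ǧ_j/g₀)^γ) = (1 + Σ_j)/P_j`**.
[cite: BauerschmidtBrydgesSlade2015LogCorr, Lemma 8.3.3 (the display μ̌'_j = L^{2j}(ǧ_j/g₀)^γ(c + O(χ_jǧ_j)))] -/
theorem dmu_div_eq (j : ℕ) :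
    D.dmu j / (L ^ (2 * j) * (D.g j / g₀) ^ γ) = (1 + D.sig L γ j) / prodFactorR D.beta D.g γ j := by
  have hL : 0 < L ^ (2 * j) := pow_pos h.L_pos _
  have hr : 0 < (D.g j / g₀) ^ γ := Real.rpow_pos_of_pos (div_pos (hG.g_pos j) hG.pos₀) γ
  rw [h.dmu_eq hG j]
  field_simp

/-- **BBS 2015, Lemma 8.3.3** (the three displays (mugzprime) and (Kprime)), for abstract sequences
obeying the differentiated flow equations with the step bounds of Theorem 6.4.1, (A2), the flow
bounds of Proposition 8.1.1, the weights and the tail bound (chigbd-bis) (`DerivFlow.Hyp`), the flow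
`ǧ` of `GchHyp` with `ρ_j ≤ Rχ_jǧ_j` (`r_j = O(χ_jǧ_j³)`), and `g₀` small (`DerivFlow.Small`): with
`c = (1 + Σ_∞)/P_∞` (`DerivFlow.cConst`) and explicit constants,
* `|c - 1| ≤ 2(M₃C_Σ + 4W)g₀` ("`c(m²,g₀) = 1 + O(g₀)`"),
* **`|μ̌'_j/(L^{2j}(ǧ_j/g₀)^γ) - c| ≤ (6W + 2M₃C_Σ)χ_jǧ_j`** ("`μ̌'_j = L^{2j}(ǧ_j/g₀)^γ(c + O(χ_jǧ_j))`"),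
* **`|ǧ'_j| ≤ 2M₁μ̌'_jǧ_j²`** ("`ǧ'_j = O(μ̌'_jǧ_j²)`"), **`|ž'_j| ≤ 2M₁χ_jμ̌'_jǧ_j²`** ("`ž'_j = O(χ_jμ̌'_jǧ_j²)`"),
* **`k_j ≤ 2M₂χ_jμ̌'_jǧ_j²`** ("`‖K'_j‖_{𝒲_j} = O(χ_jμ̌'_jǧ_j²)`"),
for all `j` (any `γ ∈ [0,1]`; the source has `γ = ¼`, `d = 4`). [cite: BauerschmidtBrydgesSlade2015LogCorr, Lemma 8.3.3] -/
theorem BBS2015_lem833 (hR : 0 ≤ R) (hρR : ∀ j, ρ j ≤ R * D.chi j * D.g j) :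
    |D.cConst L γ - 1| ≤ 2 * (M3c L γ A B M * CS + 4 * Wc γ B R CS) * g₀ ∧
    ∀ j, |D.dmu j / (L ^ (2 * j) * (D.g j / g₀) ^ γ) - D.cConst L γ| ≤
          (6 * Wc γ B R CS + 2 * M3c L γ A B M * CS) * D.chi j * D.g j ∧
        |D.dg j| ≤ 2 * M1c M * D.dmu j * D.g j ^ 2 ∧
        |D.dz j| ≤ 2 * M1c M * D.chi j * D.dmu j * D.g j ^ 2 ∧
        D.k j ≤ 2 * M2c M * D.chi j * D.dmu j * D.g j ^ 2 := by
  have hW0 : 0 ≤ Wc γ B R CS := Wc_nonneg (B := B) h.γ_nonneg hR h.CS_nonneg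
  have hWg : Wc γ B R CS * g₀ ≤ 1 / 4 := hs.W_le
  have hM3 : 0 ≤ M3c L γ A B M := (M3c_ge h.γ_nonneg h.A_nonneg hG.B_nonneg h.M_nonneg).2
  obtain ⟨hPinf1, hPinf⟩ := h.prodFactorRLim_bounds hG hR hρR (by linarith)
  have hPinf2 : 1 / 2 ≤ prodFactorRLim D.beta D.g γ := by linarith
  have hPinfpos : 0 < prodFactorRLim D.beta D.g γ := by linarith
  have hsInf := h.abs_sigLim_le hG hs
  have hsInf' : |D.sigLim L γ| ≤ 1 / 2 := by
    have : M3c L γ A B M / 2 * (CS * g₀) ≤ 1 / 2 := by nlinarith [hs.sig_le]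
    exact hsInf.trans this
  refine ⟨?_, fun j => ⟨?_, ?_, ?_, ?_⟩⟩
  · -- `c - 1 = ((1 + Σ_∞) - P_∞)/P_∞`
    unfold cConst
    rw [div_sub_one hPinfpos.ne', abs_div, abs_of_pos hPinfpos, div_le_iff₀ hPinfpos]
    calc |1 + D.sigLim L γ - prodFactorRLim D.beta D.g γ|
        = |D.sigLim L γ - (prodFactorRLim D.beta D.g γ - 1)| := by ring_nf
      _ ≤ |D.sigLim L γ| + |prodFactorRLim D.beta D.g γ - 1| := abs_sub _ _
      _ ≤ M3c L γ A B M / 2 * (CS * g₀) + 2 * (Wc γ B R CS * g₀) := add_le_add hsInf hPinf1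
      _ ≤ 2 * (M3c L γ A B M * CS + 4 * Wc γ B R CS) * g₀ * prodFactorRLim D.beta D.g γ := by
          nlinarith [mul_nonneg hM3 (mul_nonneg h.CS_nonneg hG.pos₀.le),
            mul_nonneg hW0 hG.pos₀.le]
  · -- the main display
    have hjb := h.inductive_bounds hG hs j
    have hσ : |D.sig L γ j| ≤ 1 / 2 := h.abs_sig_le_half hG hs hjb
    have hP := h.prodFactorR_ge hG hR hρR j
    have hPj : 1 / 2 ≤ prodFactorR D.beta D.g γ j := by linarith
    have hPjpos : 0 < prodFactorR D.beta D.g γ j := by linarith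
    set p := prodFactorR D.beta D.g γ j with hp
    set q := prodFactorRLim D.beta D.g γ with hq
    set a := 1 + D.sig L γ j with ha
    set a' := 1 + D.sigLim L γ with ha'
    have hn : Wc γ B R CS * D.chi j * D.g j ≤ 1 := by
      have := hG.le_two_mul j
      have := h.chi_le_one j
      have := (h.chi_pos j).le
      have := (hG.g_pos j).le
      calc Wc γ B R CS * D.chi j * D.g j ≤ Wc γ B R CS * 1 * (2 * g₀) := by
            refine mul_le_mul (mul_le_mul_of_nonneg_left ‹D.chi j ≤ 1› hW0) ‹_› ‹_› ?_
            exact mul_nonneg hW0 zero_le_one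
        _ ≤ 1 := by linarith
    have hratio := h.abs_prodFactorRLim_div_sub_one_le hG hR hρR j hn
    rw [← hp, ← hq] at hratio
    have hσdiff := h.abs_sigLim_sub_le' hG hs j
    rw [h.dmu_div_eq hG j, ← hp, ← ha]
    unfold cConst
    rw [← hq, ← ha']
    -- `a/p - a'/q = a (q/p - 1)/q + (a - a')/q`
    have hid : a / p - a' / q = (a * (q / p - 1) + (a - a')) / q := by
      field_simp
      ring
    rw [hid, abs_div, abs_of_pos hPinfpos, div_le_iff₀ hPinfpos]
    have haa : |a| ≤ 3 / 2 := by
      rw [ha]; refine (abs_add_le _ _).trans ?_; rw [abs_one]; linarith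
    have haa' : |a - a'| ≤ M3c L γ A B M * CS * D.chi j * D.g j := by
      rw [ha, ha', show (1 + D.sig L γ j) - (1 + D.sigLim L γ) = -(D.sigLim L γ - D.sig L γ j) by ring,
        abs_neg]
      exact hσdiff
    have hχg : 0 ≤ D.chi j * D.g j := mul_nonneg (h.chi_pos j).le (hG.g_pos j).le
    calc |a * (q / p - 1) + (a - a')| ≤ |a * (q / p - 1)| + |a - a'| := abs_add_le _ _
      _ ≤ 3 / 2 * (2 * (Wc γ B R CS * D.chi j * D.g j)) + M3c L γ A B M * CS * D.chi j * D.g j :=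
          add_le_add (abs_mul_le_mul haa hratio) haa'
      _ ≤ (6 * Wc γ B R CS + 2 * M3c L γ A B M * CS) * D.chi j * D.g j * q := by
          have hq1 : q ≤ 3 / 2 := by
            have := (abs_le.1 hPinf1).2; linarith
          nlinarith [mul_nonneg hW0 hχg, mul_nonneg (mul_nonneg hM3 h.CS_nonneg) hχg]
  · -- `|ǧ'_j| ≤ M₁χ_jΠ_jǧ_j² ≤ 2M₁μ̌'_jǧ_j²`
    have hjb := h.inductive_bounds hG hs j
    obtain ⟨hlo, -⟩ := h.dmu_mem hG hs hjb
    have hM1 : 0 ≤ M1c M := by linarith [(M1c_ge h.M_nonneg).1]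
    have hχ1 := h.chi_le_one j
    have hχ0 := (h.chi_pos j).le
    have hP0 := (D.prodPi_pos hG h.L_pos h.γ_nonneg h.γ_le_one j).le
    refine hjb.dg_le.trans ?_
    unfold unit
    nlinarith [mul_nonneg (mul_nonneg hM1 hP0) (sq_nonneg (D.g j)),
      mul_nonneg hM1 (sq_nonneg (D.g j))]
  · have hjb := h.inductive_bounds hG hs j
    obtain ⟨hlo, -⟩ := h.dmu_mem hG hs hjb
    have hM1 : 0 ≤ M1c M := by linarith [(M1c_ge h.M_nonneg).1]
    have hχ0 := (h.chi_pos j).le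
    refine hjb.dz_le.trans ?_
    unfold unit
    nlinarith [mul_nonneg (mul_nonneg hM1 hχ0) (sq_nonneg (D.g j))]
  · have hjb := h.inductive_bounds hG hs j
    obtain ⟨hlo, -⟩ := h.dmu_mem hG hs hjb
    have hM2 : 0 ≤ M2c M := by linarith [(M2c_ge h.M_nonneg).1]
    have hχ0 := (h.chi_pos j).le
    refine hjb.k_le.trans ?_
    unfold unit
    nlinarith [mul_nonneg (mul_nonneg hM2 hχ0) (sq_nonneg (D.g j))]

/-- **`L^{-2j}μ̌'_j → c(ǧ_∞/g₀)^γ`** whenever `ǧ_j → ǧ_∞` — the display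
"`lim_{N→∞}ν_N' = c(m²,g₀)(ǧ_∞/g₀)^γ`" of §8.3 (for `μ̌'`; there `ν_N = L^{-2N}μ_N`, `μ_j' = μ̌_j'(1 + O(μ_j))`).
[cite: BauerschmidtBrydgesSlade2015LogCorr, §8.3 (the display lim_{N→∞} ν_N' = c(m²,g₀)(ǧ_∞/g₀)^γ)] -/
theorem tendsto_dmu_div (hρR : ∀ j, ρ j ≤ R * D.chi j * D.g j) {gInf : ℝ}
    (hg : Tendsto D.g atTop (𝓝 gInf)) :
    Tendsto (fun j => D.dmu j / L ^ (2 * j)) atTop (𝓝 (D.cConst L γ * (gInf / g₀) ^ γ)) := by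
  have hsum := h.summable_log_stepFactorR' hG hρR
  -- `P_j → P_∞`
  have hP : Tendsto (prodFactorR D.beta D.g γ) atTop (𝓝 (prodFactorRLim D.beta D.g γ)) := by
    have := (Real.continuous_exp.tendsto _).comp hsum.hasSum.tendsto_sum_nat
    refine this.congr fun n => ?_
    simp only [Function.comp_apply]
    exact (hG.prodFactorR_eq_exp_sum h.γ_le_one n).symm
  have hPinf : prodFactorRLim D.beta D.g γ ≠ 0 := (GchHyp.prodFactorRLim_pos (β := D.beta) (g := D.g) (γ := γ)).ne'
  have hσ := h.tendsto_sig hG hs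
  have hq : Tendsto (fun j => D.g j / g₀) atTop (𝓝 (gInf / g₀)) := hg.div_const g₀
  have hr : Tendsto (fun j => (D.g j / g₀) ^ γ) atTop (𝓝 ((gInf / g₀) ^ γ)) :=
    hq.rpow_const (Or.inr h.γ_nonneg)
  have hmain : Tendsto (fun j => (D.g j / g₀) ^ γ * ((1 + D.sig L γ j) / prodFactorR D.beta D.g γ j))
      atTop (𝓝 ((gInf / g₀) ^ γ * ((1 + D.sigLim L γ) / prodFactorRLim D.beta D.g γ))) :=
    hr.mul ((tendsto_const_nhds.add hσ).div hP hPinf)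
  have heq : (fun j => D.dmu j / L ^ (2 * j)) =
      fun j => (D.g j / g₀) ^ γ * ((1 + D.sig L γ j) / prodFactorR D.beta D.g γ j) := by
    funext j
    have hL : (L ^ (2 * j) : ℝ) ≠ 0 := (pow_pos h.L_pos _).ne'
    rw [h.dmu_eq hG j]
    field_simp
  rw [heq]
  unfold cConst
  convert hmain using 2
  ring

end Limit

end Hyp

end DerivFlow

end CTWSAW

end Literature.Barriers.CriticalPhenomena
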